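import Summits.QuantumFields.YangMills.Theorems.BalabanUVNodesN06AtRecord11ObligationsPins
import Summits.QuantumFields.YangMills.Theorems.BalabanUVNodesN06AtRecord11ObligationsHg
import Summits.QuantumFields.YangMills.Theorems.BalabanUVNodesN06SectBOfFrameV4
import Literature.MathematicalPhysics.QuantumFieldTheory.Balaban1983to89.B9Cor35ComparisonsEH
import Literature.MathematicalPhysics.QuantumFieldTheory.Balaban1983to89.B9Ineq344LocalPairHolds
import Literature.MathematicalPhysics.QuantumFieldTheory.Balaban1983to89.B9Ineq347GAAtLetters
import Literature.MathematicalPhysics.QuantumFieldTheory.Balaban1983to89.B9Thm39ReadingAtLetters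
import Literature.MathematicalPhysics.QuantumFieldTheory.Balaban1983to89.B9Thm314Thm315RecordVacuity
import Literature.MathematicalPhysics.QuantumFieldTheory.Balaban1983to89.Node00.OpsYSectDE
import Literature.MathematicalPhysics.QuantumFieldTheory.Balaban1983to89.B9Thm312WholeLeafRelH
import Literature.MathematicalPhysics.QuantumFieldTheory.Balaban1983to89.B9Thm313WholeLeafRel
import Literature.MathematicalPhysics.QuantumFieldTheory.Balaban1983to89.B9Thm312WholeFacesY
import Literature.MathematicalPhysics.QuantumFieldTheory.Balaban1983to89.B9OpsRTransport
import Literature.MathematicalPhysics.QuantumFieldTheory.Balaban1983to89.B9CarrierBlockMultiplicity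
import Literature.MathematicalPhysics.QuantumFieldTheory.Balaban1983to89.B9CoRealizesRelAtLetters
import Literature.MathematicalPhysics.QuantumFieldTheory.Balaban1983to89.B9Ineq349SiteReading
import Literature.MathematicalPhysics.QuantumFieldTheory.Balaban1983to89.B9Eq3132AtRecordDE
import Literature.MathematicalPhysics.QuantumFieldTheory.Balaban1983to89.B9Thm314Thm315RecordDE
import Literature.MathematicalPhysics.QuantumFieldTheory.Balaban1983to89.B9Thm311ReadingAtLetters
import Literature.MathematicalPhysics.QuantumFieldTheory.Balaban1983to89.B9RWSumsDefinitePinsPairM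
import Literature.MathematicalPhysics.QuantumFieldTheory.Balaban1983to89.B9Thm311SymmAtRecordV4
import Summits.QuantumFields.YangMills.Theorems.BalabanUVNodesN06CoReadingsOfPins
import Literature.MathematicalPhysics.QuantumFieldTheory.Balaban1983to89.B9Eq3132NuReading
import Literature.MathematicalPhysics.QuantumFieldTheory.Balaban1983to89.B9GeoNbrCountKLevelV1
import Literature.MathematicalPhysics.QuantumFieldTheory.Balaban1983to89.Node00.OpsYSectEElim
import Literature.MathematicalPhysics.QuantumFieldTheory.Balaban1983to89.B9Thm311PosAtRecordV4
import Literature.MathematicalPhysics.QuantumFieldTheory.Balaban1983to89.B9CoReadingCoordsH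
import Literature.MathematicalPhysics.QuantumFieldTheory.Balaban1983to89.B9Ineq349SiteFromBlocks
import Literature.MathematicalPhysics.QuantumFieldTheory.Balaban1983to89.Node00.OpsYRecordV4
import Literature.MathematicalPhysics.QuantumFieldTheory.Balaban1983to89.B9Thm315WholeSectERepOn
import Literature.MathematicalPhysics.QuantumFieldTheory.Balaban1983to89.B9CoReadingCoordsTranspose
import Literature.MathematicalPhysics.QuantumFieldTheory.Balaban1983to89.B9CoReadingCoordsL2Pair
import Literature.MathematicalPhysics.QuantumFieldTheory.Balaban1983to89.B9CoReadingCoordsL2S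
import Literature.MathematicalPhysics.QuantumFieldTheory.Balaban1983to89.B9Thm312WholeLeafCompletePairMBZSLRC
import Literature.MathematicalPhysics.QuantumFieldTheory.Balaban1983to89.B9RWSumsCompleteGeo9YNbr
import Literature.MathematicalPhysics.QuantumFieldTheory.Balaban1983to89.B9Thm313WholeLeafCompletePairMBCZcUSXCEL
import Literature.MathematicalPhysics.QuantumFieldTheory.Balaban1983to89.B9QLettersAtPins
import Summits.QuantumFields.YangMills.Theorems.BalabanUVNodesN06ZLettersLegAtPinsPU
import Summits.QuantumFields.YangMills.Theorems.BalabanUVNodesN06ZLettersLegAtPinsPUPar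

/-!
# N06 · rows 20–21 (Theorems 3.12–3.13) at the pins on the S-LEAVES — CASCADE-K PIECE K2 (director-ym №383): face v1.7 «hrgdd LOSSY» RE-PRESSED GENERIC IN THE OPS OBJECT `𝔒`,
# THE LETTERS `𝔏`, THE AVERAGING PAIR `(𝔮, 𝔮⋆)`, THE SITE TRANSPORTER `parS` AND THE RESIDUAL LETTER `Δ⁽²⁾` — the assembler behind the knit certificate's displayed `t312K ∧ t313K`

Informal companion: `Summits/QuantumFields/YangMills/informal/balaban_uv_nodes.md` §N06.  Seat `pub-ymgap-dag-n06-l` g37; generator `work/gen/mkSUCLEPar.py` over v1.7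
`…N06Thm312313AtPinsStateSUCLE`, whose module text applies word for word to everything not listed here.  WHY.  v1.7's `t312_t313_of_pins_stateSUCLE` is keyed to TODAY's
instance: Thm-3.12∕3.13 slots of `opsYNuOfRecordV4PE N θ M⋆ 𝔯 𝔢 𝔴 𝔈`, operator letters of `lettersYOfRecordV4P N θ M⋆ 𝔯`, pins of `Q ∕ Q⋆ ∕ C ∕ C₁` and the row-26 input over the
straight-contour pair `(QY parBY, QsY parBY)` and `parSymY`.  dag-n06-d g25's knit certificate skeleton `…N06AtOpsYSectEStKnitPairKA` (generic in the letter record `𝔏`,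
instance `opsYSectESt N θ M⋆ (opsYS349NuOfLettersH N θ M⋆ 𝔏 parH 𝔈) 𝔏 (sectEStYOfRecordV7 … 𝔢₀) 𝔴`, knit record node00-def-Y's `opsYNuStOfRecordV11KSE`: averaging pair
`(qKnitOfRecord, qsKnitOfRecord)` = print's (3.115) knit letter, transporter `parKnitY`) DISPLAYS `t312K t313K` at that instance, where v1.7's keys are false.  THIS FACE is
v1.7 with the keys turned into PARAMETERS + `rfl`-PINS and the three pair∕transporter-specific derivations into displayed LAWS: binders `(𝔒 : OpsY N θ M⋆) (𝔏 : LettersY N θ M⋆)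
(𝔮 : QFamY N θ) (𝔮s : QsFamY N θ) (parS) (Δ2)` replace `𝔯 𝔢 𝔴 𝔈`; `hpinE ∕ hpinH ∕ hpinK` read `𝔒`; NEW `rfl`-pins `h𝔒GD h𝔒G₁ h𝔒GG h𝔒H h𝔒H₁` (`(𝔒 x).GD = kernelFamilyB … (𝔏 x).GD
(𝔏 x).parB`, … — def-Y's `opsYOfLetters` fields, unchanged by every `{ … with }` layer) and `h𝔒QGQ h𝔒QG1Q` (`(𝔒 x).QGQinv = siteKernelOfOpNu … (QGQinvQY x.toKIdx (𝔮 …) (𝔮s …) (parS …)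
(GpPhysY … (parS …)))`, `B9Eq3132NuReading.operatorLayerYS349Nu`'s `ν`-reading at def-Y's `𝔮`-generic (3.132) letters of `Node00.OpsYSectDQ`); the operator pins `hGco12 … hH1m12`
read `(𝔏 x).GD ∕ G₁ ∕ GG ∕ H ∕ H₁` and `hCco12 ∕ hC1co12` read def-Y's `CcoKq ∕ C1coKq … (𝔮 x.toKIdx) (𝔮s x.toKIdx) (parS x.toKIdx) (GpPhysY x.toKIdx (parS x.toKIdx)) [Δ2 x]` —
`Node00.OpsYOps312OfRecordPar.pins312Par_of_eq`'s shapes VERBATIM; `hsymD` reads `(𝔏 x).GD ∕ G₁ ∕ GG`; `hH1N hIF hHCN` read `kernelFamilyR R₁ R₂ (𝔒 x).GD …`; `h26` = KA's `s3132K`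
VERBATIM (`siteKernelR R₁ R₂ (𝔒 x).QGQinv ∕ .QG1Qinv`); GONE `hQco12 hQsco12 hM12q hB12₃q hΔ2`, REPLACED by the LAWS `hqK` (`Q : 𝔠⁽ᵖ⁾ → 𝔠_Z⁽ᵖ⁾`, `p ≤ 2`, `BQp·e^{−δ12₃d}`; today
= dag-n06-w5's `hasMaj_Q_of_pins` + the (2.60) numerics, knit = dag-n06-c's (L7) sizes), `hqsK` (`Q⋆ : 𝔠⁽⁰⁾ → Z_{n⁻¹}`, `BQ·e^{−δQ d}`, `δQ ≥ δ12₃ + σ12`; the law of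
`…N06G0QstarLettersLegAtPinsPUPar`) and `hC1T` (`C₁(U)` its own counting transpose for SU(N)-valued `U`; today = w5's `isTransposePair_C1coK` + def-Y's
`G1Y_GpPhysY_isSymmTr_parSymY`, the symmetry step of dag-n06-c's `c1L2_of_pinsR`); the Z-letters leg is `…N06ZLettersLegAtPinsPUPar.zletters_of_laws`, the block-L² `c1` field
w5's `c1_l2_of_c1_2` (Schur).  CONCLUSION = KA's `t312K ∧ t313K` VERBATIM with `𝔒` for the instance.  BINDER LEDGER vs v1.7: GONE 9 (`𝔯 𝔢 𝔴 𝔈 hQco12 hQsco12 hM12q hB12₃q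
hΔ2`), NEW 22 (`𝔒 𝔏 𝔮 𝔮s parS Δ2`, pins `h𝔒GD h𝔒G₁ h𝔒GG h𝔒H h𝔒H₁ h𝔒QGQ h𝔒QG1Q`, laws `BQp hBQp hqK BQ δQ hBQ hδQ hqsK hC1T`), RETYPED 15 (`hpinE hpinH hpinK hGco12 hG1co12 hGGco12
hHm12 hH1m12 hCco12 hC1co12 hsymD hH1N hIF hHCN h26`, re-keyed only), everything else IDENTICAL.  At today's record (`𝔒 := opsYNuOfRecordV4PE …`, `𝔏 := lettersYOfRecordV4P …`,
`𝔮 := fun i => QY i (parBY i)`, `𝔮s := fun i => QsY i (parBY i)`, `parS := parSymY`, `Δ2 := fun x => (𝔯 x).Δ2`) the new pins hold by `rfl` (`CcoKq_QY`; the two (3.132)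
pins are def-Y's `opsYNuOfRecordV4PE_QGQinv_QG1Qinv`) and v1.7 is the instance; at a KA-type instance `opsYSectESt … (opsYS349NuOfLetters[H] … 𝔏 …) 𝔏 𝔢 𝔴` every `𝔒`-pin is `rfl`.
HONEST LABEL: Bałaban's theorems AS PRINTED over finite tori; kernel bookkeeping; displayed rows and laws are HYPOTHESES; helper, count-neutral; N06 NOT discharged by this file;
nothing continuum ∕ OS ∕ mass gap ∕ Clay.
[cite: Balaban1985BackgroundPropagators, Thm 3.12 pp.421–423, Thm 3.13 pp.423–426, (3.44)–(3.45) p.398, (3.49) p.399, (3.115) p.418, (3.130)–(3.133) pp.421–422, (3.151)–(3.153) p.426, (3.46) p.398; Balaban1984PropagatorsII, (2.51)–(2.56) pp.232–233, Lemma 2.1 (2.60)–(2.61) p.234]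
-/

noncomputable section

namespace Summit.QuantumFields.YangMills.BalabanUVNodes.N06Thm312313AtPinsStateSUCLEPar


open Literature.MathematicalPhysics.QuantumFieldTheory.Balaban1983to89.B9QLettersAtPins (hasMaj_Q_of_pins) open Summit.QuantumFields.YangMills.BalabanUVNodes.N06ZLettersLegAtPinsPU (scaled_rates) open Summit.QuantumFields.YangMills.BalabanUVNodes.N06ZLettersLegAtPinsPUPar (zletters_of_laws) open Literature.MathematicalPhysics.QuantumFieldTheory.Balaban1983to89.Node00.OpsYOps312OfRecordPar (CcoKq C1coKq) open Literature.MathematicalPhysics.QuantumFieldTheory.Balaban1983to89.Node00.OpsYQLetter (QFamY QsFamY) open Literature.MathematicalPhysics.QuantumFieldTheory.Balaban1983to89.B9LettersZCFieldsAtPins (c1_l2_of_c1_2) open Literature.MathematicalPhysics.QuantumFieldTheory.Balaban1983to89.B9Thm37Glue (IsTransposePair) open Literature.MathematicalPhysics.QuantumFieldTheory.Balaban1983to89.B9LettersZSchemasMono (kernel_mono letters313DZ_mono letters313DMZ_mono) open Literature.MathematicalPhysics.QuantumFieldTheory.Balaban1983to89.B9Eq3132SectDLetters (QGQinvY) open Literature.MathematicalPhysics.QuantumFieldTheory.Balaban1983to89.B9Eq3132NuReading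 (siteKernelOfOpNu nuY) open Literature.MathematicalPhysics.QuantumFieldTheory.Balaban1983to89.B9LettersHZAtOne (plateau_pos) open Literature.MathematicalPhysics.QuantumFieldTheory.Balaban1983to89.B7Prop2SpecialUnitary (specialUnitaryUnits_le_U1) open Literature.MathematicalPhysics.QuantumFieldTheory.Balaban1983to89.Node00.OpsYSectDCoords (QcoKH QscoKH CcoK C1coK)
open Literature.MathematicalPhysics.QuantumFieldTheory.Balaban1983to89.B9BackgroundsKLevelV1R (RegFamY bg9YR MemOfFam mem_of_reg335R kernelFamilyR kernelFamilyRY hKernelR hKernelRY siteKernelR) open Literature.MathematicalPhysics.QuantumFieldTheory.Balaban1983to89.B9OpsRTransport (ops312RY)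
open Literature.MathematicalPhysics.QuantumFieldTheory.Balaban1983to89 open Literature.MathematicalPhysics.QuantumFieldTheory.Balaban1983to89.T4Continuum (T4Family) open Literature.MathematicalPhysics.QuantumFieldTheory.Balaban1983to89.DagBinding (WorldP leavesP) open Literature.MathematicalPhysics.QuantumFieldTheory.Balaban1983to89.Node00 open Literature.MathematicalPhysics.QuantumFieldTheory.Balaban1983to89.B6KLevelCensusIndexV1 (KIdx) open Literature.MathematicalPhysics.QuantumFieldTheory.Balaban1983to89.B9PinMembersKLevelV1 (MemberY geo9Y bg9Y) open Literature.MathematicalPhysics.QuantumFieldTheory.Balaban1983to89.B9PinGeometryKLevelV1 (dOmegaY OmKY inΛY unitDistY InCubeY c35Y c35Y_pos) open Literature.MathematicalPhysics.QuantumFieldTheory.Balaban1983to89.B7Prop2SpecialUnitary (specialUnitaryUnits specialUnitaryUnits_le_unitaryUnits) open Literature.MathematicalPhysics.QuantumFieldTheory.Balaban1983to89.B9Ineq347GAAtLetters (hGA_opsYOfLetters) open Literature.MathematicalPhysics.QuantumFieldTheory.Balaban1983to89.B9Ineq344LocalPairHolds (hGp_opsYOfLetters_holds) open Literature.Mathe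maticalPhysics.QuantumFieldTheory.Balaban1983to89.B9Cor35ComparisonsGAAtLetters
  (hGA_e_opsYOfLetters hGA_h1_opsYOfLetters hGA_e4_opsYOfLetters hGA_h2_opsYOfLetters hGA_l2_opsYOfLetters)
open Literature.MathematicalPhysics.QuantumFieldTheory.Balaban1983to89.B9Cor35ComparisonsGpCAtLetters (hGp_e_opsYOfLetters hGp_h1_opsYOfLetters hC_opsYOfLetters) open Literature.MathematicalPhysics.QuantumFieldTheory.Balaban1983to89.B9Cor35ComparisonsEH (hE4_of_hGA_e4 hH2_of_hGA_h2) open Literature.MathematicalPhysics.QuantumFieldTheory.Balaban1983to89.B9Thm314Thm315RecordVacuity (thm315FullPrinted_of_ker_zero) open Literature.MathematicalPhysics.QuantumFieldTheory.Balaban1983to89.B9RecordDELettersVacuity (siteKernelOfOp_zero_ker fineKernelOfOp_zero_ker stmt349Printed_of_ker_zero) open Literature.MathematicalPhysics.QuantumFieldTheory.Balaban1983to89.B9GeoLemma21KLevelV1 (geo9Y_len_pos) open Literature.MathematicalPhysics.QuantumFieldTheory.Balaban1983to89.B9Thm311Whole (PosDefOfOps) open Literature.MathematicalPhysics.QuantumFieldTheory.Balaban1983to89.B9Thm39Whole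 (WalkReading39) open Literature.MathematicalPhysics.QuantumFieldTheory.Balaban1983to89.B9Thm39WholeBlk (Ops39Blk StaticOK39Blk Locality39Blk Local348Blk Identities395Blk Small285Blk Factors389Blk)
open Literature.MathematicalPhysics.QuantumFieldTheory.Balaban1983to89.B9Thm39WholeBlkViaDatum (EK39OfOpsBlkVia) open Literature.MathematicalPhysics.QuantumFieldTheory.Balaban1983to89.B9Thm39ReadingCoords (repSite39) open Literature.MathematicalPhysics.QuantumFieldTheory.Balaban1983to89.B9Thm39ReadingAtLetters (X39 blk39 L39 t39_hksum_of_pins_opsYOfLetters) open Literature.MathematicalPhysics.QuantumFieldTheory.Balaban1983to89.B9RowSum261DefiniteFaces (rowConst261) open Summit.QuantumFields.YangMills.BalabanUVNodes.N06AtRecord11ObligationsPins (t311_of_pin) open Summit.QuantumFields.YangMills.BalabanUVNodes.N06AtRecord11ObligationsHg (hg_obligation_vacuous) open Summit.QuantumFields.YangMills.BalabanUVNodes.N06AtRecord11CB10YZW (b9_main_of_up_view₁₁B10YZW_of_obligations) open Literature.MathematicalPhysics.QuantumFieldTheory.Balaban1983to89.B9Thm312Whole (GeoOK Thm33G0 FormSmall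 HasRWExpOfOps HasRWExpHOfOps PosDefKOfOps) open Literature.MathematicalPhysics.QuantumFieldTheory.Balaban1983to89.B11SectG (RowSum BlockNorm) open Literature.MathematicalPhysics.QuantumFieldTheory.Balaban1983to89.B9FromB6 (L2Block) open Literature.MathematicalPhysics.QuantumFieldTheory.Balaban1983to89.B9Thm312WholeH (LettersH) open Literature.MathematicalPhysics.QuantumFieldTheory.Balaban1983to89.B9Thm312WholeLeft (LeftStep)
open Literature.MathematicalPhysics.QuantumFieldTheory.Balaban1983to89.B9Thm313WholeLeft (Letters313D) open Literature.MathematicalPhysics.QuantumFieldTheory.Balaban1983to89.B9Thm313Whole (Letters313) open Literature.MathematicalPhysics.QuantumFieldTheory.Balaban1983to89.B9Ineq347CoReading (CoReadsGlob) open Literature.MathematicalPhysics.QuantumFieldTheory.Balaban1983to89.B9Thm312WholeFacesY (lemma21AboveG_geo9Y) open Literature.MathematicalPhysics.QuantumFieldTheory.Balaban1983to89.B9GeoNormsKLevelV1 (geo9K_dist_nonneg) open Literature.MathematicalPhysics.QuantumFieldTheory.Balaban1983to89.B9GeoLemma21KLevelV1 (distOK_geo9Y rowSum261_geo9Y geo9Y_dist_triangle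 geo9Y_dist_comm) open Literature.MathematicalPhysics.QuantumFieldTheory.Balaban1983to89.B9GeoNormsKLevelModelSignsV1 (modelSignsOn_geo9K) open Literature.MathematicalPhysics.QuantumFieldTheory.Balaban1983to89.B9Thm34Ext (toB6) open Literature.MathematicalPhysics.QuantumFieldTheory.Balaban1983to89.B9CoRealizesRel (CoRealizesRel) open Literature.MathematicalPhysics.QuantumFieldTheory.Balaban1983to89.B9CoRealizesRelAtLetters (RelB maj342_relB_left maj342_relB_right dist_eq_of_relB len_eq_of_relB relB_refl)
open Literature.MathematicalPhysics.QuantumFieldTheory.Balaban1983to89.B9CoRealizesHRel (CoRealizesHRel) open Literature.MathematicalPhysics.QuantumFieldTheory.Balaban1983to89.B9SectCDiffDict (maj342) open Literature.MathematicalPhysics.QuantumFieldTheory.Balaban1983to89.B6Ineq2142KLevelV1 (β) open Literature.MathematicalPhysics.QuantumFieldTheory.Balaban1983to89.B9CarrierBlockMultiplicity (card_sameCarrier_le_kIdx) open Literature.MathematicalPhysics.QuantumFieldTheory.Balaban1983to89.B9Thm312WholeLeafRelH (thm312Printed_of_stepRelH) open Literature.MathematicalPhysics.QuantumFieldTheory.Balaban1983to89.B9Thm313WholeLeafRel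 (thm313Printed_of_stepRel) open Literature.MathematicalPhysics.QuantumFieldTheory.Balaban1983to89.B9Eq3132SectDLetters (QGQY) open Literature.MathematicalPhysics.QuantumFieldTheory.Balaban1983to89.B9Eq3132CTInputs (CoerciveUnder DecayUnder) open Literature.MathematicalPhysics.QuantumFieldTheory.Balaban1983to89.B9Eq3132ScalarIndex (geoComap) open Literature.MathematicalPhysics.QuantumFieldTheory.Balaban1983to89.B9Eq3132RingInverseReading (normMatY) open Literature.MathematicalPhysics.QuantumFieldTheory.Balaban1983to89.B9Ineq349SiteReading (opsYS349OfRecordDE) open Literature.MathematicalPhysics.QuantumFieldTheory.Balaban1983to89.B9Eq3132AtRecordDE (s3132_opsYOfRecordDE)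
open Literature.MathematicalPhysics.QuantumFieldTheory.Balaban1983to89.B9Thm314Thm315RecordDE (thm314_pair_opsYOfRecordDE t315_opsYOfRecordDE_of_slots) open Literature.MathematicalPhysics.QuantumFieldTheory.Balaban1983to89.B9Thm311ReadingAtLetters (ops311Y) open Literature.MathematicalPhysics.QuantumFieldTheory.Balaban1983to89.B9Thm311ReadingCoords (PosDefTr) open Literature.MathematicalPhysics.QuantumFieldTheory.Balaban1983to89.B9Thm311SymmAtRecordV4 (proofLettersOneV4) open Literature.MathematicalPhysics.QuantumFieldTheory.Balaban1983to89.B9Thm311PosAtRecordV4 (t311_of_pins_opsYOfLettersV4₁) open Literature.MathematicalPhysics.QuantumFieldTheory.Balaban1983to89.B9PinGeometryKLevelV1 (kLab) open Literature.MathematicalPhysics.QuantumFieldTheory.Balaban1983to89.B9Thm314GpFlatTorusGeometry (tdistK OmegaC) open Literature.MathematicalPhysics.QuantumFieldTheory.Balaban1983to89.B9Thm314WholePinGeometry (locDataY) open Literature.MathematicalPhysics.QuantumFieldTheory.Balaban1983to89.B9Thm314WholePair (locData₂) open Literature.MathematicalPhysics.QuantumFieldTheory.Balaban1983to89.B9Thm314WholePairWalks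 (pairWalkSets) open Literature.MathematicalPhysics.QuantumFieldTheory.Balaban1983to89.B9Thm314WholeSummation (WalkSetsSpec WalkWeightsSummable) open Literature.MathematicalPhysics.QuantumFieldTheory.Balaban1983to89.B9SectCWalkTermsAllNorms (Thm310AllNormsPrinted) open Literature.MathematicalPhysics.QuantumFieldTheory.Balaban1983to89.B9Thm314WholeExpansionReads (ExpansionReads) open Literature.MathematicalPhysics.QuantumFieldTheory.Balaban1983to89.B9Thm314WholeCancellationLayer (pairOp) open Literature.MathematicalPhysics.QuantumFieldTheory.Balaban1983to89.B9Thm37Whole (Ops Sizes StaticOK Local342 Identities)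
open Literature.MathematicalPhysics.QuantumFieldTheory.Balaban1983to89.B9Cor38Whole (WalkReading Locality) open Literature.MathematicalPhysics.QuantumFieldTheory.Balaban1983to89.B9Thm310Whole (Ops310 WalkReading310 Sizes310 StaticOK310 Locality310 Local342G Identities310) open Literature.MathematicalPhysics.QuantumFieldTheory.Balaban1983to89.B9RWSumsDefinitePins (PinPrims) open Literature.MathematicalPhysics.QuantumFieldTheory.Balaban1983to89.B9RWSumsDefinitePinsPair (PairPrims) open Literature.MathematicalPhysics.QuantumFieldTheory.Balaban1983to89.B9RWSumsDefinitePinsPairM (MixedPrims E37YPairM E310YPairM rows131819_definite_geo9Y_pairM) open Literature.MathematicalPhysics.QuantumFieldTheory.Balaban1983to89.B9RWSums344InputFam (InputReadsFam sliceProbe) open Literature.MathematicalPhysics.QuantumFieldTheory.Balaban1983to89.B9RWSums344InputPair (InputLegsPair37 FactorsInputPair37 DirSupHolder37 InputLegsPair310 FactorsInputPair310 DirSupHolder310) open Literature.MathematicalPhysics.QuantumFieldTheory.Balaban1983to89.B9RWSums346MixedPair (L2MixedLegs37 FactorsL2Mixed37 DirSup37 L2MixedLegs310 FactorsL2Mixed310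 DirSup310) open Literature.MathematicalPhysics.QuantumFieldTheory.Balaban1983to89.B9CoReadingCoordsTranspose (TrIdx trBasis isTransposePair_GcoK_trBasis isTransposePair_DcoK_GcoK_trBasis isTransposePair_GcoS_trBasis isTransposePair_DcoS_GcoS_trBasis) open Literature.MathematicalPhysics.QuantumFieldTheory.Balaban1983to89.B9Thm311SymmAtRecordV4 (symm0_parSymY symmG_parSymY) open Literature.MathematicalPhysics.QuantumFieldTheory.Balaban1983to89.B9Thm311AdjointPairs (GpY_isSymmTr) open Literature.MathematicalPhysics.QuantumFieldTheory.Balaban1983to89.B9RWSums346SecondDiff (familyOp DirOps310 DirTranspose310 L2SecondLegs310 FactorsL2Second310) open Literature.MathematicalPhysics.QuantumFieldTheory.Balaban1983to89.B9RWSums346SecondDiffGp (DirOps37 DirTranspose37 L2SecondLegs37 FactorsL2Second37) open Literature.MathematicalPhysics.QuantumFieldTheory.Balaban1983to89.B9Thm37Glue (IsTransposePair) open Literature.MathematicalPhysics.QuantumFieldTheory.Balaban1983to89.B9RWSums343to347Whole (GlobReads) open Literature.MathematicalPhysics.QuantumFieldTheory.Balaban1983to89.B9RWSumsReadsNbr (nbr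 L2ReadsNbr H1ReadsNbr InputReadsNbr) open Literature.MathematicalPhysics.QuantumFieldTheory.Balaban1983to89.B9RWSums346Two (L2TwoLegs310 FactorsL2_310) open Literature.MathematicalPhysics.QuantumFieldTheory.Balaban1983to89.B9RWSums346TwoGp (L2TwoLegs37 FactorsL2_37) open Literature.MathematicalPhysics.QuantumFieldTheory.Balaban1983to89.B9RWSums344Input (InputLegs310 FactorsInput310)
open Literature.MathematicalPhysics.QuantumFieldTheory.Balaban1983to89.B9RWSums344InputGp (InputLegs37 FactorsInput37) open Literature.MathematicalPhysics.QuantumFieldTheory.Balaban1983to89.B9RWSums343Holder (HolderProbes HolderLegs310 FactorsHolder310) open Literature.MathematicalPhysics.QuantumFieldTheory.Balaban1983to89.B9RWSums343HolderGp (HolderLegs37 HolderV37) open Literature.MathematicalPhysics.QuantumFieldTheory.Balaban1983to89.B9SectBStepFrameV4 (SectBFrame₄) open Summit.QuantumFields.YangMills.BalabanUVNodes.N06SectBOfFrameV4 (hB_obligation_of_sectBFrame₄)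
open Literature.MathematicalPhysics.QuantumFieldTheory.Balaban1983to89.B9CoReadingCoords (XBK evBK blkBK GcoK DcoK DscoK LcoK coordOpK cdBₗ cdsBₗ) open Literature.MathematicalPhysics.QuantumFieldTheory.Balaban1983to89.B9CoReadingCoordsS (XSK evSK blkSK sIK sIK_faithful GcoS DcoS DscoS LcoS) open Literature.MathematicalPhysics.QuantumFieldTheory.Balaban1983to89.B9CoReadingCoordsL2S (sIK_dist_le_one site_l2ReadsNbr012_of_pins site_l2ReadsNbr345_of_pins) open Literature.MathematicalPhysics.QuantumFieldTheory.Balaban1983to89.B9CoReadingCoordsL2Pair (bond_l2ReadsNbr345_of_pins) open Literature.MathematicalPhysics.QuantumFieldTheory.Balaban1983to89.B9Ineq349SiteComposite (cdSL cdsSL) open Literature.MathematicalPhysics.QuantumFieldTheory.Balaban1983to89.B9Thm312WholeLeafCompletePairM (thm312Printed_completePairM) open Literature.MathematicalPhysics.QuantumFieldTheory.Balaban1983to89.B9RWSumsCompleteGeo9YNbr (len_le_of_dist_le_two_geo9Y one_le_L_nat) open Literature.MathematicalPhysics.QuantumFieldTheory.Balaban1983to89.B9Thm312WholeDir (Thm33G0Dir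 Thm33G0L2M StepDir) open Literature.MathematicalPhysics.QuantumFieldTheory.Balaban1983to89.B9Thm312WholeL2 (StepL2) open Literature.MathematicalPhysics.QuantumFieldTheory.Balaban1983to89.B9Thm312WholeHHolder (LettersHH) open Literature.MathematicalPhysics.QuantumFieldTheory.Balaban1983to89.B9Thm312WholeHHolderNbr (CoReadsHHolderNbr) open Literature.MathematicalPhysics.QuantumFieldTheory.Balaban1983to89.B9Thm311ReadingCoords (IsSymmTr) open Summit.QuantumFields.YangMills.BalabanUVNodes.N06CoReadingsOfPins (bond_coReadings3_of_pins bond_coReadingsLap_of_pins site_coReadings4_of_pins bond_l2ReadsNbr3_of_pins) open Literature.MathematicalPhysics.QuantumFieldTheory.Balaban1983to89.B6Geom246MultiLevelTorus (geomT)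
open Literature.MathematicalPhysics.QuantumFieldTheory.Balaban1983to89.B9Eq3132NuReading (opsYS349NuOfLetters lamInvY) open Literature.MathematicalPhysics.QuantumFieldTheory.Balaban1983to89.B9GeoNbrCountKLevelV1 (nbrM₀Y nbrCountY hnbr_two_of_le) open Literature.MathematicalPhysics.QuantumFieldTheory.Balaban1983to89.B9CoReadingCoordsH (XHK blkHK HcoK coRealizesHRel_of_pins)
open Literature.MathematicalPhysics.QuantumFieldTheory.Balaban1983to89.B9Ineq349SiteFromBlocks (Thm31SiteSchemas Thm32BlkSchema stmt349Printed_site_of_blockSchemas) open Literature.MathematicalPhysics.QuantumFieldTheory.Balaban1983to89.B6GlobalChartV1 (blkV1) open Literature.MathematicalPhysics.QuantumFieldTheory.Balaban1983to89.B6Ineq2142KLevelV1 (lvl) open Literature.MathematicalPhysics.QuantumFieldTheory.Balaban1983to89.B9Thm315WholeSectERep (LocalOuterY) open Literature.MathematicalPhysics.QuantumFieldTheory.Balaban1983to89.B9Thm315WholeSectERepOn (DecayMidOnY t315_opsYSectE_of_3185_on) open Literature.MathematicalPhysics.QuantumFieldTheory.Balaban1983to89.B9Thm314WholeCancellationLayer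 (thm314_pair_layerOfLetters) open Literature.MathematicalPhysics.QuantumFieldTheory.Balaban1983to89.B9Thm314WholePinGeometry (locDataY_laws) open Literature.MathematicalPhysics.QuantumFieldTheory.Balaban1983to89.B9PinGeometryKLevelV1 (dOmegaY_nonneg) open scoped Matrix.Norms.L2Operator
open Literature.MathematicalPhysics.QuantumFieldTheory.Balaban1983to89.B9Thm313WholeLeafCompletePairMBCZcUSXCEL (thm313Printed_completePairMBCZcUSXCEL) open Literature.MathematicalPhysics.QuantumFieldTheory.Balaban1983to89.B9Thm313WholeLettersCut (Letters313Zc Letters313HZc Letters313L2Pc) open Literature.MathematicalPhysics.QuantumFieldTheory.Balaban1983to89.B9Thm313WholeRgdFrom3152 (Ids3152) open Literature.MathematicalPhysics.QuantumFieldTheory.Balaban1983to89.B9Thm313WholeZ (Letters313Z) open Literature.MathematicalPhysics.QuantumFieldTheory.Balaban1983to89.B9Thm313WholeLeftZ (Letters313DZ) open Literature.MathematicalPhysics.QuantumFieldTheory.Balaban1983to89.B9Thm313WholeDirZ (Letters313DMZ) open Literature.MathematicalPhysics.QuantumFieldTheory.Balaban1983to89.B9Thm313WholeHolderZ (Letters313HZ)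 open Literature.MathematicalPhysics.QuantumFieldTheory.Balaban1983to89.B9Thm313WholeL2GPZ (Letters313L2PZ) open Literature.MathematicalPhysics.QuantumFieldTheory.Balaban1983to89.B9Thm313WholeDirL2Z (Letters313L2MZ) open Literature.MathematicalPhysics.QuantumFieldTheory.Balaban1983to89.B9Thm312WholeLeafCompletePairMBZSLRC (thm312Printed_completePairMBZSL_ratesC) open Literature.MathematicalPhysics.QuantumFieldTheory.Balaban1983to89.B9Thm312WholeHZ (LettersHZ LettersHHZ) open Literature.MathematicalPhysics.QuantumFieldTheory.Balaban1983to89.B9SectDSup (weightNorm) open Literature.MathematicalPhysics.QuantumFieldTheory.Balaban1983to89.B9Thm313WholeDir (Thm33G0DirR Letters313DM Letters313L2M) open Literature.MathematicalPhysics.QuantumFieldTheory.Balaban1983to89.B9Thm313WholeHolder (Letters313H) open Literature.MathematicalPhysics.QuantumFieldTheory.Balaban1983to89.B9Thm313WholeL2GP (Letters313L2P)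

open B9Thm312WholeStepRegular (StepS) open B6RandomWalkHom (HasMajorantHom) open B9Thm312WholeClasses (cNormR rwt rwt_nonneg) open B9Thm312Whole (cNorm) open B11SectG (HasMaj) open B9SectDSup (weightNorm_κ)

variable {N : ℕ}

section Pointed

set_option maxHeartbeats 400000 in
set_option synthInstance.maxSize 512 in
/-- ★★★ **ROWS 20–21 AT THE PINS ON THE S-LEAVES, FACE v1.7 «hrgdd LOSSY», RE-PRESSED GENERIC IN `(𝔒, 𝔏, 𝔮, 𝔮⋆, parS, Δ⁽²⁾)` [CASCADE-K K2]** — the assembler behind the knit certificate's displayed `t312K ∧ t313K`: the ops object `𝔒` enters through the Thm-3.12∕3.13 slot pins `hpinE∕H∕K` and the `rfl`-pins `h𝔒GD … h𝔒QG1Q` of its Sect.-D kernel slots to the letters `𝔏` and to def-Y's `𝔮`-generic (3.132) letters; the pins of `C ∕ C₁` read `CcoKq ∕ C1coKq`; the `Q ∕ Q⋆` letters and `C₁`'s self-transpose are displayed LAWS `hqK hqsK hC1T`; everything else is **FACE v1.7 (v1.6 «c1 INSIDE» + the displayed letter `hrgdd13` in print's lossy Hölder species): class-parametric carrier `bg9YR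 R₁ R₂`, `U`-dependent Hölder intermediates `bH13 bXH bHW13`, the step and the
one-step pairs out of the regular state classes `𝔖₂ ∕ 𝔖₁`, NO raw Δ⁽²⁾ letter; Z-letter display `hZ2` (gD2 gQs1); the (3.132) letters from ROW 26 (`h26`), `gQs2 ∕ dgQs` from the G₀ layer,
`q2 ∕ q1` from the pin of Q, `rgd2` as `hrgd2_13`; master rates scaled after row 26's produced rate** (module docstring).
[cite: Balaban1985BackgroundPropagators, Thm 3.12 pp.421–423, Thm 3.13 pp.423–426, (3.130)–(3.133) pp.421–422, (3.138) p.423, (3.151)–(3.153) p.426, (3.35)–(3.36) p.396; Balaban1984PropagatorsII, (2.51)–(2.56) pp.232–233, Lemma 2.1 (2.60)–(2.61) p.234] -/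
theorem t312_t313_of_pins_stateSUCLE_par (θ : Stage3Params) (Mstar : ℕ) {R₁ R₂ : RegFamY θ.d₆ θ.ℓ₆ θ.hd' θ.hL' θ.b₀ θ.b₁ Mstar (Matrix (Fin N) (Fin N) ℂ)}
    (hGR : MemOfFam (specialUnitaryUnits (Fin N)) R₁) (c : ℝ)
    -- [CASCADE-K] the ops object, the letters, the averaging pair, the site transporter and the residual letter as PARAMETERS (v1.7: `opsYNuOfRecordV4PE … 𝔯 𝔢 𝔴 𝔈`, `lettersYOfRecordV4P … 𝔯`, `(QY parBY, QsY parBY)`, `parSymY`, `(𝔯 x).Δ2`)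
    (𝔒 : OpsY N θ Mstar) (𝔏 : LettersY N θ Mstar) (𝔮 : QFamY N θ) (𝔮s : QsFamY N θ) (parS : ∀ i : KIdx θ.d₆ θ.ℓ₆ θ.hd' θ.hL' θ.b₀ θ.b₁, SiteParY (Matrix (Fin N) (Fin N) ℂ) i)
    (Δ2 : ∀ x : MemberY θ.d₆ θ.ℓ₆ θ.hd' θ.hL' θ.b₀ θ.b₁ Mstar, BondOpY (Matrix (Fin N) (Fin N) ℂ) x.toKIdx)
    [∀ x : MemberY θ.d₆ θ.ℓ₆ θ.hd' θ.hL' θ.b₀ θ.b₁ Mstar, Fintype (geo9Y x).Site] [∀ x : MemberY θ.d₆ θ.ℓ₆ θ.hd' θ.hL' θ.b₀ θ.b₁ Mstar, DecidableEq (geo9Y x).Site] [∀ x : MemberY θ.d₆ θ.ℓ₆ θ.hd' θ.hL' θ.b₀ θ.b₁ Mstar, DecidableRel (RelB x.toKIdx)]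
    (bI : ∀ x : MemberY θ.d₆ θ.ℓ₆ θ.hd' θ.hL' θ.b₀ θ.b₁ Mstar, FBondY x.toKIdx → IBondY x.toKIdx)
    (hβI : ∀ (x : MemberY θ.d₆ θ.ℓ₆ θ.hd' θ.hL' θ.b₀ θ.b₁ Mstar) (f : FBondY x.toKIdx) (c : IBondY x.toKIdx), blkV1 x.hN x.D f = β x.hN x.D x.hk c → β x.hN x.D x.hk (bI x f) = blkV1 x.hN x.D f)
    (hlev : ∀ (x : MemberY θ.d₆ θ.ℓ₆ θ.hd' θ.hL' θ.b₀ θ.b₁ Mstar) (f : FBondY x.toKIdx), lvl x.hN x.D x.hk (bI x f) = (blkV1 x.hN x.D f).1.1)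
    (hβ1 : ∀ (x : MemberY θ.d₆ θ.ℓ₆ θ.hd' θ.hL' θ.b₀ θ.b₁ Mstar) (f : FBondY x.toKIdx), (geomT x.D).dist (β x.hN x.D x.hk (bI x f)) (blkV1 x.hN x.D f) ≤ 1)
    (hM₀ : nbrM₀Y θ.d₆ θ.ℓ₆ θ.hd' θ.hL' θ.b₀ θ.b₁ 2 ≤ Mstar) {PXA PYA : MemberY θ.d₆ θ.ℓ₆ θ.hd' θ.hL' θ.b₀ θ.b₁ Mstar → Type} [∀ x, Fintype (PXA x)] [∀ x, DecidableEq (PXA x)] [∀ x, Fintype (PYA x)] [∀ x, DecidableEq (PYA x)]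
    (𝔭A : ∀ x : MemberY θ.d₆ θ.ℓ₆ θ.hd' θ.hL' θ.b₀ θ.b₁ Mstar, HolderProbes (geo9Y x) (bg9YR (Matrix (Fin N) (Fin N) ℂ) (specialUnitaryUnits (Fin N)) R₁ R₂ x) (XBK (TrIdx N) x.toKIdx) (XBK (TrIdx N) x.toKIdx) (PXA x) (PYA x))
    -- the single-direction letters ∇_{U,μ} ∕ ∇*_{U,μ} on the bond carrier (in the certificate: `(𝔡A x).Dd ∕ .Dsd` of the Theorem-3.10 letters), PINNED to the coordinate letters
    (Dd Dds : ∀ x : MemberY θ.d₆ θ.ℓ₆ θ.hd' θ.hL' θ.b₀ θ.b₁ Mstar, (bg9YR (Matrix (Fin N) (Fin N) ℂ) (specialUnitaryUnits (Fin N)) R₁ R₂ x).Cfg → Fin (θ.d₆ + 1) → Module.End ℝ (XBK (TrIdx N) x.toKIdx → ℝ))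
    (hDd : ∀ (x : MemberY θ.d₆ θ.ℓ₆ θ.hd' θ.hL' θ.b₀ θ.b₁ Mstar) (U : (bg9YR (Matrix (Fin N) (Fin N) ℂ) (specialUnitaryUnits (Fin N)) R₁ R₂ x).Cfg), Dd x U = fun μ => coordOpK (trBasis N) (fun _ : Fin (θ.d₆ + 1) => cdBₗ x.toKIdx U μ)) (hDds : ∀ (x : MemberY θ.d₆ θ.ℓ₆ θ.hd' θ.hL' θ.b₀ θ.b₁ Mstar) (U : (bg9YR (Matrix (Fin N) (Fin N) ℂ) (specialUnitaryUnits (Fin N)) R₁ R₂ x).Cfg), Dds x U = fun μ => coordOpK (trBasis N) (fun _ : Fin (θ.d₆ + 1) => cdsBₗ x.toKIdx U μ))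
    {W12 : MemberY θ.d₆ θ.ℓ₆ θ.hd' θ.hL' θ.b₀ θ.b₁ Mstar → Type} [∀ x, Fintype (W12 x)]
    (𝔬12 : ∀ x : MemberY θ.d₆ θ.ℓ₆ θ.hd' θ.hL' θ.b₀ θ.b₁ Mstar, B9Thm312Whole.Ops (geo9Y x) (bg9YR (Matrix (Fin N) (Fin N) ℂ) (specialUnitaryUnits (Fin N)) R₁ R₂ x) (XBK (TrIdx N) x.toKIdx) (XBK (TrIdx N) x.toKIdx) (XHK (TrIdx N) x.toKIdx) (W12 x)) (H12 : MemberY θ.d₆ θ.ℓ₆ θ.hd' θ.hL' θ.b₀ θ.b₁ Mstar → Prop)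
    (bH13 : ∀ x : MemberY θ.d₆ θ.ℓ₆ θ.hd' θ.hL' θ.b₀ θ.b₁ Mstar, (bg9YR (Matrix (Fin N) (Fin N) ℂ) (specialUnitaryUnits (Fin N)) R₁ R₂ x).Cfg → BlockNorm (toB6 (geo9Y x) 1 (H12 x)) (W12 x → ℝ)) (θD12 r12 B12₀ δ12₀ δK12 σ12 ρ12 a12 M12 B12₃ δ12₃ ρ13 α12 κ13 : ℝ) (hθD12 : 0 ≤ θD12) (hr12 : 0 ≤ r12)
    (θ2₁₂ B12₂ ρf12 : ℝ) (θH12 Bh12 Bi12 Bq12 : ℝ → ℝ) (Bi2₁₂ : ℝ → ℝ → ℝ) (hθH12 : ∀ β, 0 ≤ β → β < 1 → 0 ≤ θH12 β) (hθ2₁₂ : 0 ≤ θ2₁₂) (hB12₂ : 0 ≤ B12₂) (hρf12 : 0 < ρf12) (hρf1 : ρf12 + σ12 ≤ (1 - α12) * ρ12)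
    (hρf2 : ρf12 + 2 * σ12 + α12 * ρ12 ≤ ρ12) (hBh12 : ∀ β, 0 ≤ β → β < 1 → 0 ≤ Bh12 β) (hBi12 : ∀ ε, 0 < ε → ε ≤ 1 → 0 ≤ Bi12 ε) (hBi2₁₂ : ∀ ε β, 0 < ε → ε ≤ 1 → 0 ≤ β → β < 1 → 0 ≤ Bi2₁₂ ε β) (hBq12 : ∀ β, 0 ≤ Bq12 β)
    (bHX12 : ∀ x : MemberY θ.d₆ θ.ℓ₆ θ.hd' θ.hL' θ.b₀ θ.b₁ Mstar, ℝ → BlockNorm (toB6 (geo9Y x) 1 (H12 x)) ((XBK (TrIdx N) x.toKIdx) → ℝ))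
    (hB12₀ : 0 ≤ B12₀) (hB12₃ : 0 ≤ B12₃) (hσ12 : 0 < σ12) (hρ12 : 0 < ρ12) (hρS12 : ρ12 ≤ δ12₀) (hρδ12 : ρ12 + 2 * σ12 ≤ δK12) (hρ₃12 : ρ12 + σ12 ≤ δ12₃) (ha12 : 0 < a12) (hM12 : 0 < M12) (hα12 : 0 < α12) (hα12' : α12 ≤ 1 / 2)
    (hκ13 : ∀ x U, (bH13 x U).κ ≤ κ13) (hρ13 : 0 < ρ13) (hρ13ρ : ρ13 + 5 * σ12 ≤ ρ12) (hσρ13 : 3 * σ12 < (1 - α12) * ρ13)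
    (B13₄ : ℝ) (BhD13 Bx13 Bd13 : ℝ → ℝ) (Br13 Bd2₁₃ : ℝ → ℝ → ℝ) (hB13₄ : 0 ≤ B13₄) (hBr13 : ∀ ε ε', 0 < ε' → ε' < 1 → ε' < ε → ε ≤ ε' + 1 → 0 ≤ Br13 ε ε') (hBhD13 : ∀ β, 0 ≤ β → β < 1 → 0 ≤ BhD13 β) (hBx13 : ∀ β, 0 ≤ β → β < 1 → 0 ≤ Bx13 β)
    (hBd13 : ∀ ε, 0 < ε → ε ≤ 1 → 0 ≤ Bd13 ε) (hBd2₁₃ : ∀ ε β, 0 < ε → ε ≤ 1 → 0 ≤ β → β < 1 → 0 ≤ Bd2₁₃ ε β) (bHW13 : ∀ x : MemberY θ.d₆ θ.ℓ₆ θ.hd' θ.hL' θ.b₀ θ.b₁ Mstar, (bg9YR (Matrix (Fin N) (Fin N) ℂ) (specialUnitaryUnits (Fin N)) R₁ R₂ x).Cfg → ℝ → BlockNorm (toB6 (geo9Y x) 1 (H12 x)) (W12 x → ℝ)) (hκW13 : ∀ x U ε, (bHW13 x U ε).κ ≤ κ13)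
    (Gp : ∀ x : MemberY θ.d₆ θ.ℓ₆ θ.hd' θ.hL' θ.b₀ θ.b₁ Mstar, (bg9YR (Matrix (Fin N) (Fin N) ℂ) (specialUnitaryUnits (Fin N)) R₁ R₂ x).Cfg → Module.End ℝ (W12 x → ℝ))
    (bXH : ∀ x : MemberY θ.d₆ θ.ℓ₆ θ.hd' θ.hL' θ.b₀ θ.b₁ Mstar, (bg9YR (Matrix (Fin N) (Fin N) ℂ) (specialUnitaryUnits (Fin N)) R₁ R₂ x).Cfg → BlockNorm (toB6 (geo9Y x) 1 (H12 x)) (XBK (TrIdx N) x.toKIdx → ℝ)) (hκX : ∀ x U, (bXH x U).κ ≤ κ13)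
    (hmodel12 : ∀ x : MemberY θ.d₆ θ.ℓ₆ θ.hd' θ.hL' θ.b₀ θ.b₁ Mstar, M12 ≤ (geo9Y x).M → ∀ α₀ : ℝ, 0 < α₀ → (geo9Y x).M * α₀ ≤ a12 → ∀ U : (bg9YR (Matrix (Fin N) (Fin N) ℂ) (specialUnitaryUnits (Fin N)) R₁ R₂ x).Cfg, (bg9YR (Matrix (Fin N) (Fin N) ℂ) (specialUnitaryUnits (Fin N)) R₁ R₂ x).Reg335 c α₀ U → (bg9YR (Matrix (Fin N) (Fin N) ℂ) (specialUnitaryUnits (Fin N)) R₁ R₂ x).Reg336 c α₀ U → FormSmall (𝔬12 x) (r12 * ((geo9Y x).M * α₀)) U ∧ B9Thm312Whole.Identities (𝔬12 x) U)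
    (hpinE : ∀ x : MemberY θ.d₆ θ.ℓ₆ θ.hd' θ.hL' θ.b₀ θ.b₁ Mstar, (𝔒 x).HasRWExp = HasRWExpOfOps (ops312RY (𝔬12 x)))
    (hpinH : ∀ x : MemberY θ.d₆ θ.ℓ₆ θ.hd' θ.hL' θ.b₀ θ.b₁ Mstar, (𝔒 x).HasRWExpH = HasRWExpHOfOps (ops312RY (𝔬12 x)))
    (hpinK : ∀ x : MemberY θ.d₆ θ.ℓ₆ θ.hd' θ.hL' θ.b₀ θ.b₁ Mstar, (𝔒 x).PosDefK = PosDefKOfOps (ops312RY (𝔬12 x)))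
    -- [CASCADE-K] the `rfl`-PINS of the ops object's Sect.-D kernel slots to the letters (node00-def-Y `opsYOfLetters`: `GD ∕ G₁ ∕ GG := kernelFamilyB … 𝔏.GD … 𝔏.parB`, `H ∕ H₁ := hKernelOfOp …`; `B9Eq3132NuReading.operatorLayerYS349Nu`: `QGQinv ∕ QG1Qinv := siteKernelOfOpNu … 𝔏.QGQinv …` with the (3.132) letters `QGQinvQY ∕ QG1QinvQY` of `Node00.OpsYSectDQ` at `(𝔮, 𝔮⋆, parS, GpPhysY parS, Δ2)`)
    (h𝔒GD : ∀ x : MemberY θ.d₆ θ.ℓ₆ θ.hd' θ.hL' θ.b₀ θ.b₁ Mstar, (𝔒 x).GD = kernelFamilyB x.toKIdx (bg9Y (Matrix (Fin N) (Fin N) ℂ) (specialUnitaryUnits (Fin N)) x) (fun U => U) (𝔏 x).GD (𝔏 x).parB) (h𝔒G₁ : ∀ x : MemberY θ.d₆ θ.ℓ₆ θ.hd' θ.hL' θ.b₀ θ.b₁ Mstar, (𝔒 x).G₁ = kernelFamilyB x.toKIdx (bg9Y (Matrix (Fin N) (Fin N) ℂ) (specialUnitaryUnits (Fin N)) x) (fun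 U => U) (𝔏 x).G₁ (𝔏 x).parB) (h𝔒GG : ∀ x : MemberY θ.d₆ θ.ℓ₆ θ.hd' θ.hL' θ.b₀ θ.b₁ Mstar, (𝔒 x).GG = kernelFamilyB x.toKIdx (bg9Y (Matrix (Fin N) (Fin N) ℂ) (specialUnitaryUnits (Fin N)) x) (fun U => U) (𝔏 x).GG (𝔏 x).parB)
    (h𝔒H : ∀ x : MemberY θ.d₆ θ.ℓ₆ θ.hd' θ.hL' θ.b₀ θ.b₁ Mstar, (𝔒 x).H = hKernelOfOp x.toKIdx (bg9Y (Matrix (Fin N) (Fin N) ℂ) (specialUnitaryUnits (Fin N)) x) (fun U => U) (𝔏 x).H (𝔏 x).parB) (h𝔒H₁ : ∀ x : MemberY θ.d₆ θ.ℓ₆ θ.hd' θ.hL' θ.b₀ θ.b₁ Mstar, (𝔒 x).H₁ = hKernelOfOp x.toKIdx (bg9Y (Matrix (Fin N) (Fin N) ℂ) (specialUnitaryUnits (Fin N)) x) (fun U => U) (𝔏 x).H₁ (𝔏 x).parB)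
    (h𝔒QGQ : ∀ x : MemberY θ.d₆ θ.ℓ₆ θ.hd' θ.hL' θ.b₀ θ.b₁ Mstar, (𝔒 x).QGQinv = siteKernelOfOpNu x.toKIdx (bg9Y (Matrix (Fin N) (Fin N) ℂ) (specialUnitaryUnits (Fin N)) x) (fun U => U) (nuY (θ.d₆ + 1) x.toKIdx) (QGQinvQY x.toKIdx (𝔮 x.toKIdx) (𝔮s x.toKIdx) (parS x.toKIdx) (GpPhysY x.toKIdx (parS x.toKIdx)))) (h𝔒QG1Q : ∀ x : MemberY θ.d₆ θ.ℓ₆ θ.hd' θ.hL' θ.b₀ θ.b₁ Mstar, (𝔒 x).QG1Qinv = siteKernelOfOpNu x.toKIdx (bg9Y (Matrix (Fin N) (Fin N) ℂ) (specialUnitaryUnits (Fin N)) x) (fun U => U) (nuY (θ.d₆ + 1) x.toKIdx) (QG1QinvQY x.toKIdx (𝔮 x.toKIdx) (𝔮s x.toKIdx) (parS x.toKIdx) (GpPhysY x.toKIdx (parS x.toKIdx)) (Δ2 x)))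
    -- PINS of Theorems 3.12–3.13's walk letters to the coordinate models of the GENUINE `GD G₁ GG` — the nine `CoRealizesRel` and nine `CoReadsGlob` co-readings are theorems
    (hblk12 : ∀ x : MemberY θ.d₆ θ.ℓ₆ θ.hd' θ.hL' θ.b₀ θ.b₁ Mstar, (𝔬12 x).blk = blkBK x.toKIdx (bI x)) (hblkY12 : ∀ x : MemberY θ.d₆ θ.ℓ₆ θ.hd' θ.hL' θ.b₀ θ.b₁ Mstar, (𝔬12 x).blkY = blkBK x.toKIdx (bI x))
    (hGco12 : ∀ (x : MemberY θ.d₆ θ.ℓ₆ θ.hd' θ.hL' θ.b₀ θ.b₁ Mstar) (U : (bg9YR (Matrix (Fin N) (Fin N) ℂ) (specialUnitaryUnits (Fin N)) R₁ R₂ x).Cfg), (𝔬12 x).G U = GcoK x.toKIdx (trBasis N) (bg9YR (Matrix (Fin N) (Fin N) ℂ) (specialUnitaryUnits (Fin N)) R₁ R₂ x) (fun U => U) (𝔏 x).GD U)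
    (hG1co12 : ∀ (x : MemberY θ.d₆ θ.ℓ₆ θ.hd' θ.hL' θ.b₀ θ.b₁ Mstar) (U : (bg9YR (Matrix (Fin N) (Fin N) ℂ) (specialUnitaryUnits (Fin N)) R₁ R₂ x).Cfg), (𝔬12 x).G1 U = GcoK x.toKIdx (trBasis N) (bg9YR (Matrix (Fin N) (Fin N) ℂ) (specialUnitaryUnits (Fin N)) R₁ R₂ x) (fun U => U) (𝔏 x).G₁ U)
    (hGGco12 : ∀ (x : MemberY θ.d₆ θ.ℓ₆ θ.hd' θ.hL' θ.b₀ θ.b₁ Mstar) (U : (bg9YR (Matrix (Fin N) (Fin N) ℂ) (specialUnitaryUnits (Fin N)) R₁ R₂ x).Cfg), (𝔬12 x).GG U = GcoK x.toKIdx (trBasis N) (bg9YR (Matrix (Fin N) (Fin N) ℂ) (specialUnitaryUnits (Fin N)) R₁ R₂ x) (fun U => U) (𝔏 x).GG U)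
    (hDco12 : ∀ (x : MemberY θ.d₆ θ.ℓ₆ θ.hd' θ.hL' θ.b₀ θ.b₁ Mstar) (U : (bg9YR (Matrix (Fin N) (Fin N) ℂ) (specialUnitaryUnits (Fin N)) R₁ R₂ x).Cfg), (𝔬12 x).D U = DcoK x.toKIdx (trBasis N) (bg9YR (Matrix (Fin N) (Fin N) ℂ) (specialUnitaryUnits (Fin N)) R₁ R₂ x) (fun U => U) U)
    (hDsco12 : ∀ (x : MemberY θ.d₆ θ.ℓ₆ θ.hd' θ.hL' θ.b₀ θ.b₁ Mstar) (U : (bg9YR (Matrix (Fin N) (Fin N) ℂ) (specialUnitaryUnits (Fin N)) R₁ R₂ x).Cfg), (𝔬12 x).Dstar U = DscoK x.toKIdx (trBasis N) (bg9YR (Matrix (Fin N) (Fin N) ℂ) (specialUnitaryUnits (Fin N)) R₁ R₂ x) (fun U => U) U)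
    (hblkZ12 : ∀ x : MemberY θ.d₆ θ.ℓ₆ θ.hd' θ.hL' θ.b₀ θ.b₁ Mstar, (𝔬12 x).blkZ = blkHK x.toKIdx)
    (hHm12 : ∀ (x : MemberY θ.d₆ θ.ℓ₆ θ.hd' θ.hL' θ.b₀ θ.b₁ Mstar) (U : (bg9YR (Matrix (Fin N) (Fin N) ℂ) (specialUnitaryUnits (Fin N)) R₁ R₂ x).Cfg), (𝔬12 x).Hm U = HcoK x.toKIdx (trBasis N) (bg9YR (Matrix (Fin N) (Fin N) ℂ) (specialUnitaryUnits (Fin N)) R₁ R₂ x) (fun U => U) (𝔏 x).H U)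
    (hH1m12 : ∀ (x : MemberY θ.d₆ θ.ℓ₆ θ.hd' θ.hL' θ.b₀ θ.b₁ Mstar) (U : (bg9YR (Matrix (Fin N) (Fin N) ℂ) (specialUnitaryUnits (Fin N)) R₁ R₂ x).Cfg), (𝔬12 x).H1m U = HcoK x.toKIdx (trBasis N) (bg9YR (Matrix (Fin N) (Fin N) ℂ) (specialUnitaryUnits (Fin N)) R₁ R₂ x) (fun U => U) (𝔏 x).H₁ U)
    -- row 20's Hölder ∕ input ∕ H-Hölder co-readings on the PAIR family through the bond-carrier probes `𝔭A` (one probe family per carrier), and Theorem 3.3 ∕ the perturbation step ∕ the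
    -- H-letters in n06-l's direction-indexed schemas at the pinned single-direction letters `Dd ∕ Dds` (printed-shape hypothesis schemas; nothing of print asserted)
    (hH1N : ∀ (x : MemberY θ.d₆ θ.ℓ₆ θ.hd' θ.hL' θ.b₀ θ.b₁ Mstar) (U : (bg9YR (Matrix (Fin N) (Fin N) ℂ) (specialUnitaryUnits (Fin N)) R₁ R₂ x).Cfg), H1ReadsNbr (kernelFamilyR R₁ R₂ (𝔒 x).GD) U (𝔭A x) (RelB x.toKIdx) 2 (𝔬12 x).blk (𝔬12 x).blkY (evBK x.toKIdx) (evBK x.toKIdx) ((𝔬12 x).D U ∘ₗ (𝔬12 x).G U) ((𝔬12 x).G U ∘ₗ (𝔬12 x).Dstar U) ∧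
      H1ReadsNbr (kernelFamilyR R₁ R₂ (𝔒 x).G₁) U (𝔭A x) (RelB x.toKIdx) 2 (𝔬12 x).blk (𝔬12 x).blkY (evBK x.toKIdx) (evBK x.toKIdx) ((𝔬12 x).D U ∘ₗ (𝔬12 x).G1 U) ((𝔬12 x).G1 U ∘ₗ (𝔬12 x).Dstar U) ∧
      H1ReadsNbr (kernelFamilyR R₁ R₂ (𝔒 x).GG) U (𝔭A x) (RelB x.toKIdx) 2 (𝔬12 x).blk (𝔬12 x).blkY (evBK x.toKIdx) (evBK x.toKIdx) ((𝔬12 x).D U ∘ₗ (𝔬12 x).GG U) ((𝔬12 x).GG U ∘ₗ (𝔬12 x).Dstar U))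
    (hIF : ∀ (x : MemberY θ.d₆ θ.ℓ₆ θ.hd' θ.hL' θ.b₀ θ.b₁ Mstar) (U : (bg9YR (Matrix (Fin N) (Fin N) ℂ) (specialUnitaryUnits (Fin N)) R₁ R₂ x).Cfg), InputReadsFam (kernelFamilyR R₁ R₂ (𝔒 x).GD) U (bHX12 x) 2 ((𝔬12 x).blk ∘ Prod.fst) ((𝔭A x).blkPX ∘ Prod.fst) (fun β => sliceProbe ((𝔭A x).ΦX U β)) (evBK x.toKIdx) (familyOp fun q : Fin (θ.d₆ + 1) × Fin (θ.d₆ + 1) => (Dd x) U q.1 ∘ₗ ((𝔬12 x).G U ∘ₗ (Dds x) U q.2)) ∧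
      InputReadsFam (kernelFamilyR R₁ R₂ (𝔒 x).G₁) U (bHX12 x) 2 ((𝔬12 x).blk ∘ Prod.fst) ((𝔭A x).blkPX ∘ Prod.fst) (fun β => sliceProbe ((𝔭A x).ΦX U β)) (evBK x.toKIdx) (familyOp fun q : Fin (θ.d₆ + 1) × Fin (θ.d₆ + 1) => (Dd x) U q.1 ∘ₗ ((𝔬12 x).G1 U ∘ₗ (Dds x) U q.2)) ∧
      InputReadsFam (kernelFamilyR R₁ R₂ (𝔒 x).GG) U (bHX12 x) 2 ((𝔬12 x).blk ∘ Prod.fst) ((𝔭A x).blkPX ∘ Prod.fst) (fun β => sliceProbe ((𝔭A x).ΦX U β)) (evBK x.toKIdx) (familyOp fun q : Fin (θ.d₆ + 1) × Fin (θ.d₆ + 1) => (Dd x) U q.1 ∘ₗ ((𝔬12 x).GG U ∘ₗ (Dds x) U q.2)))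
    (hHCN : ∀ (x : MemberY θ.d₆ θ.ℓ₆ θ.hd' θ.hL' θ.b₀ θ.b₁ Mstar) (U : (bg9YR (Matrix (Fin N) (Fin N) ℂ) (specialUnitaryUnits (Fin N)) R₁ R₂ x).Cfg), CoReadsHHolderNbr (hKernelR R₁ R₂ (𝔒 x).H) U (θ.d₆ + 1) (𝔭A x) 2 (𝔬12 x).blkZ ((𝔬12 x).D U ∘ₗ (𝔬12 x).Hm U) ∧ CoReadsHHolderNbr (hKernelR R₁ R₂ (𝔒 x).H₁) U (θ.d₆ + 1) (𝔭A x) 2 (𝔬12 x).blkZ ((𝔬12 x).D U ∘ₗ (𝔬12 x).H1m U))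
    (hsymD : ∀ (x : MemberY θ.d₆ θ.ℓ₆ θ.hd' θ.hL' θ.b₀ θ.b₁ Mstar) (U : (bg9YR (Matrix (Fin N) (Fin N) ℂ) (specialUnitaryUnits (Fin N)) R₁ R₂ x).Cfg), (∀ μ z, U μ z ∈ specialUnitaryUnits (Fin N)) → IsSymmTr (fun _ => (1 : ℝ)) ((𝔏 x).GD U) ∧ IsSymmTr (fun _ => (1 : ℝ)) ((𝔏 x).G₁ U) ∧ IsSymmTr (fun _ => (1 : ℝ)) ((𝔏 x).GG U))
    (hG0C : ∀ x : MemberY θ.d₆ θ.ℓ₆ θ.hd' θ.hL' θ.b₀ θ.b₁ Mstar, M12 ≤ (geo9Y x).M → ∀ α₀ : ℝ, 0 < α₀ → (geo9Y x).M * α₀ ≤ a12 → ∀ U : (bg9YR (Matrix (Fin N) (Fin N) ℂ) (specialUnitaryUnits (Fin N)) R₁ R₂ x).Cfg, (bg9YR (Matrix (Fin N) (Fin N) ℂ) (specialUnitaryUnits (Fin N)) R₁ R₂ x).Reg335 c α₀ U → (bg9YR (Matrix (Fin N) (Fin N) ℂ) (specialUnitaryUnits (Fin N)) R₁ R₂ x).Reg336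 c α₀ U →  Thm33G0Dir (𝔬12 x) (𝔭A x) (Dd x) (Dds x) 1 (H12 x) (bHX12 x) B12₀ Bh12 Bi12 Bi2₁₂ δ12₀ U ∧ Thm33G0DirR (𝔬12 x) (Dds x) 1 (H12 x) B12₀ δ12₀ U ∧
      Thm33G0L2M (𝔬12 x) (Dd x) (Dds x) 1 (H12 x) B12₂ δ12₀ U)
    (hStL : ∀ x : MemberY θ.d₆ θ.ℓ₆ θ.hd' θ.hL' θ.b₀ θ.b₁ Mstar, M12 ≤ (geo9Y x).M → ∀ α₀ : ℝ, 0 < α₀ → (geo9Y x).M * α₀ ≤ a12 → ∀ U : (bg9YR (Matrix (Fin N) (Fin N) ℂ) (specialUnitaryUnits (Fin N)) R₁ R₂ x).Cfg, (bg9YR (Matrix (Fin N) (Fin N) ℂ) (specialUnitaryUnits (Fin N)) R₁ R₂ x).Reg335 c α₀ U → (bg9YR (Matrix (Fin N) (Fin N) ℂ) (specialUnitaryUnits (Fin N)) R₁ R₂ x).Reg336 c α₀ U →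
  StepL2 (𝔬12 x) 1 (H12 x) (θ2₁₂ * ((geo9Y x).M * α₀)) δK12 U)
    (hLHH : ∀ x : MemberY θ.d₆ θ.ℓ₆ θ.hd' θ.hL' θ.b₀ θ.b₁ Mstar, M12 ≤ (geo9Y x).M → ∀ α₀ : ℝ, 0 < α₀ → (geo9Y x).M * α₀ ≤ a12 → ∀ U : (bg9YR (Matrix (Fin N) (Fin N) ℂ) (specialUnitaryUnits (Fin N)) R₁ R₂ x).Cfg, (bg9YR (Matrix (Fin N) (Fin N) ℂ) (specialUnitaryUnits (Fin N)) R₁ R₂ x).Reg335 c α₀ U → (bg9YR (Matrix (Fin N) (Fin N) ℂ) (specialUnitaryUnits (Fin N)) R₁ R₂ x).Reg336 c α₀ U →  LettersHHZ (𝔬12 x) (𝔭A x) 1 (H12 x) (fun y => (geo9Y_len_pos x y).le) (weightNorm (BlockNorm.ofBlocks (toB6 (geo9Y x) 1 (H12 x)) (𝔬12 x).blkZ) (fun y => ((((θ.ℓ₆ + 1 : ℕ) : ℝ) ^ (θ.d₆ + 1)) ^ lvl x.hN x.D x.hk y)⁻¹) (fun y => (plateau_pos x.toKIdx y).le)) Bq12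 δ12₃ U)
    (hLH3 : ∀ x : MemberY θ.d₆ θ.ℓ₆ θ.hd' θ.hL' θ.b₀ θ.b₁ Mstar, M12 ≤ (geo9Y x).M → ∀ α₀ : ℝ, 0 < α₀ → (geo9Y x).M * α₀ ≤ a12 → ∀ U : (bg9YR (Matrix (Fin N) (Fin N) ℂ) (specialUnitaryUnits (Fin N)) R₁ R₂ x).Cfg, (bg9YR (Matrix (Fin N) (Fin N) ℂ) (specialUnitaryUnits (Fin N)) R₁ R₂ x).Reg335 c α₀ U → (bg9YR (Matrix (Fin N) (Fin N) ℂ) (specialUnitaryUnits (Fin N)) R₁ R₂ x).Reg336 c α₀ U → Letters313HZc (𝔬12 x) (𝔭A x) (Gp x) 1 (H12 x) ⟨geo9Y_dist_triangle x, geo9Y_dist_comm x, geo9K_dist_nonneg x.toKIdx, geo9Y_len_pos x⟩ (fun y => ((((θ.ℓ₆ + 1 : ℕ) : ℝ) ^ (θ.d₆ + 1)) ^ lvl x.hN x.D x.hk y)⁻¹) (fun y => plateau_pos x.toKIdx y) (bH13 x U) BhD13 Bx13 δ12₃ (bXH x U) U)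
    -- face v1.6 (dag-n06-d LOCATED-c1): the block-L² pair record WITHOUT its `c1` field — the pair letters as a FUNCTION of `c1`, monotone in the letters (B′ ≥ B13₄, δ′ ≤ δ12₃), at the L² weight v_Z = √n⁻¹;
    -- `c1` itself is DERIVED inside (row 26 → `zletters_of_pins` conjunct 5 → dag-n06-c's `c1L2_of_pinsR`); the direction letters as before
    (hLL2 : ∀ x : MemberY θ.d₆ θ.ℓ₆ θ.hd' θ.hL' θ.b₀ θ.b₁ Mstar, M12 ≤ (geo9Y x).M → ∀ α₀ : ℝ, 0 < α₀ → (geo9Y x).M * α₀ ≤ a12 → ∀ U : (bg9YR (Matrix (Fin N) (Fin N) ℂ) (specialUnitaryUnits (Fin N)) R₁ R₂ x).Cfg, (bg9YR (Matrix (Fin N) (Fin N) ℂ) (specialUnitaryUnits (Fin N)) R₁ R₂ x).Reg335 c α₀ U → (bg9YR (Matrix (Fin N) (Fin N) ℂ) (specialUnitaryUnits (Fin N)) R₁ R₂ x).Reg336 c α₀ U → (∀ B' δ' : ℝ, B13₄ ≤ B' → δ' ≤ δ12₃ → B9SectDL2Decay.BlockBd (g := toB6 (geo9Y x) 1 (H12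 x)) (𝔬12 x).blkZ (𝔬12 x).blkZ ((𝔬12 x).C1 U) (fun (y y' : (geo9Y x).Site) => B' * (Real.sqrt ((((θ.ℓ₆ + 1 : ℕ) : ℝ) ^ (θ.d₆ + 1)) ^ lvl x.hN x.D x.hk y)⁻¹ * (geo9Y x).len y)⁻¹ * (Real.sqrt ((((θ.ℓ₆ + 1 : ℕ) : ℝ) ^ (θ.d₆ + 1)) ^ lvl x.hN x.D x.hk y')⁻¹ * (geo9Y x).len y')⁻¹ * Real.exp (-(δ' * (geo9Y x).dist y y'))) →
        Letters313L2Pc (𝔬12 x) (Dd x) (Dds x) 1 (H12 x) B' δ' (fun y => Real.sqrt ((((θ.ℓ₆ + 1 : ℕ) : ℝ) ^ (θ.d₆ + 1)) ^ lvl x.hN x.D x.hk y)⁻¹) (fun y => Real.sqrt_pos.2 (plateau_pos x.toKIdx y)) U) ∧ Letters313L2MZ (𝔬12 x) (Dd x) (Dds x) 1 (H12 x) B13₄ δ12₃ (fun y => Real.sqrt ((((θ.ℓ₆ + 1 : ℕ) : ℝ) ^ (θ.d₆ + 1)) ^ lvl x.hN x.D x.hk y)⁻¹) (fun y => Real.sqrt_pos.2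 (plateau_pos x.toKIdx y)) U)
    -- the (3.152)–(3.153) input letters FIELD-WISE (dag-n06-l P-U8S″: no `Letters313IMBC` record, hence no right form `tDv` and no θ_V letter)
    (hrgdd13 : ∀ x : MemberY θ.d₆ θ.ℓ₆ θ.hd' θ.hL' θ.b₀ θ.b₁ Mstar, M12 ≤ (geo9Y x).M → ∀ α₀ : ℝ, 0 < α₀ → (geo9Y x).M * α₀ ≤ a12 → ∀ U : (bg9YR (Matrix (Fin N) (Fin N) ℂ) (specialUnitaryUnits (Fin N)) R₁ R₂ x).Cfg, (bg9YR (Matrix (Fin N) (Fin N) ℂ) (specialUnitaryUnits (Fin N)) R₁ R₂ x).Reg335 c α₀ U → (bg9YR (Matrix (Fin N) (Fin N) ℂ) (specialUnitaryUnits (Fin N)) R₁ R₂ x).Reg336 c α₀ U →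
        ∀ (μ : Fin (θ.d₆ + 1)) (ε ε' : ℝ), 0 < ε' → ε' < 1 → ε' < ε → ε ≤ ε' + 1 →
          HasMaj (bHX12 x ε) (bHW13 x U ε') ((𝔬12 x).R U ∘ₗ (𝔬12 x).Dvstar U ∘ₗ (𝔬12 x).G1 U ∘ₗ Dds x U μ) (fun a b => Br13 ε ε' * Real.exp (-(δ12₃ * (geo9Y x).dist a b))))
    (hdgDvd13 : ∀ x : MemberY θ.d₆ θ.ℓ₆ θ.hd' θ.hL' θ.b₀ θ.b₁ Mstar, M12 ≤ (geo9Y x).M → ∀ α₀ : ℝ, 0 < α₀ → (geo9Y x).M * α₀ ≤ a12 → ∀ U : (bg9YR (Matrix (Fin N) (Fin N) ℂ) (specialUnitaryUnits (Fin N)) R₁ R₂ x).Cfg, (bg9YR (Matrix (Fin N) (Fin N) ℂ) (specialUnitaryUnits (Fin N)) R₁ R₂ x).Reg335 c α₀ U → (bg9YR (Matrix (Fin N) (Fin N) ℂ) (specialUnitaryUnits (Fin N)) R₁ R₂ x).Reg336 c α₀ U →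
        ∀ (ν : Fin (θ.d₆ + 1)) (ε : ℝ), 0 < ε → ε ≤ 1 → HasMaj (bHW13 x U ε) (BlockNorm.ofBlocks (toB6 (geo9Y x) 1 (H12 x)) (𝔬12 x).blk)
          (Dd x U ν ∘ₗ ((𝔬12 x).G0 U ∘ₗ (𝔬12 x).Dv U)) (fun (a b : (geo9Y x).Site) => Bd13 ε * Real.exp (-(δ12₃ * (geo9Y x).dist a b))))
    (hpdgDvd13 : ∀ x : MemberY θ.d₆ θ.ℓ₆ θ.hd' θ.hL' θ.b₀ θ.b₁ Mstar, M12 ≤ (geo9Y x).M → ∀ α₀ : ℝ, 0 < α₀ → (geo9Y x).M * α₀ ≤ a12 → ∀ U : (bg9YR (Matrix (Fin N) (Fin N) ℂ) (specialUnitaryUnits (Fin N)) R₁ R₂ x).Cfg, (bg9YR (Matrix (Fin N) (Fin N) ℂ) (specialUnitaryUnits (Fin N)) R₁ R₂ x).Reg335 c α₀ U → (bg9YR (Matrix (Fin N) (Fin N) ℂ) (specialUnitaryUnits (Fin N)) R₁ R₂ x).Reg336 c α₀ U →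
        ∀ (ν : Fin (θ.d₆ + 1)) (ε β : ℝ), 0 < ε → ε ≤ 1 → 0 ≤ β → β < 1 →
          HasMaj (bHW13 x U (β + ε)) (BlockNorm.ofBlocks (toB6 (geo9Y x) 1 (H12 x)) (𝔭A x).blkPX)
            (((𝔭A x).ΦX U β ∘ₗ Dd x U ν) ∘ₗ ((𝔬12 x).G0 U ∘ₗ (𝔬12 x).Dv U))
            (fun (a b : (geo9Y x).Site) => Bd2₁₃ ε β * (geo9Y x).len a ^ (-β) * Real.exp (-(δ12₃ * (geo9Y x).dist a b))))
    -- face v1.5: the TWO displayed Z-letters gD2 gQs1; gQs2 ∕ dgQs from the G₀ layer (`hG0e`, `he1`), c2 ∕ c12 ∕ c1_2 ∕ c1_1 from ROW 26 (`h26`), rgd2 := `hrgd2_13`, q2 q1 from the pin `hQco12`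
    (hZ2 : ∀ x : MemberY θ.d₆ θ.ℓ₆ θ.hd' θ.hL' θ.b₀ θ.b₁ Mstar, M12 ≤ (geo9Y x).M → ∀ α₀ : ℝ, 0 < α₀ → (geo9Y x).M * α₀ ≤ a12 → ∀ U : (bg9YR (Matrix (Fin N) (Fin N) ℂ) (specialUnitaryUnits (Fin N)) R₁ R₂ x).Cfg, (bg9YR (Matrix (Fin N) (Fin N) ℂ) (specialUnitaryUnits (Fin N)) R₁ R₂ x).Reg335 c α₀ U → (bg9YR (Matrix (Fin N) (Fin N) ℂ) (specialUnitaryUnits (Fin N)) R₁ R₂ x).Reg336 c α₀ U →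
        HasMaj (cNorm 1 (H12 x) (𝔬12 x).blkW (fun y => (geo9Y_len_pos x y).le) 1) (cNorm 1 (H12 x) (𝔬12 x).blk (fun y => (geo9Y_len_pos x y).le) 2) ((𝔬12 x).G0 U ∘ₗ (𝔬12 x).Dv U) (fun a b => B12₃ * Real.exp (-(δ12₃ * (geo9Y x).dist a b))) ∧
        HasMaj (weightNorm (BlockNorm.ofBlocks (toB6 (geo9Y x) 1 (H12 x)) (𝔬12 x).blkZ) (fun y => (geo9Y x).len y * ((((θ.ℓ₆ + 1 : ℕ) : ℝ) ^ (θ.d₆ + 1)) ^ lvl x.hN x.D x.hk y)⁻¹) fun y => (mul_pos (geo9Y_len_pos x y) (plateau_pos x.toKIdx y)).le) (cNorm 1 (H12 x) (𝔬12 x).blk (fun y => (geo9Y_len_pos x y).le) 1) ((𝔬12 x).G0 U ∘ₗ (𝔬12 x).Qstar U) (fun a b => B12₃ * Real.exp (-(δ12₃ * (geo9Y x).dist a b))))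
    -- face v1.5 (P-DISP 3): the pins of Q\*, C, C₁ (the certificate's `hQsco12 hCco12 hC1co12`), the G₀ sup letter (its `(hmodel12 …).1`), ROW 26 as it holds it (`h26 := s3132`)
    (hCco12 : ∀ (x : MemberY θ.d₆ θ.ℓ₆ θ.hd' θ.hL' θ.b₀ θ.b₁ Mstar) (U : (bg9YR (Matrix (Fin N) (Fin N) ℂ) (specialUnitaryUnits (Fin N)) R₁ R₂ x).Cfg), (𝔬12 x).C U = CcoKq x.toKIdx (trBasis N) (bg9YR (Matrix (Fin N) (Fin N) ℂ) (specialUnitaryUnits (Fin N)) R₁ R₂ x) (fun U => U) (𝔮 x.toKIdx) (𝔮s x.toKIdx) (parS x.toKIdx) (GpPhysY x.toKIdx (parS x.toKIdx)) U)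
    (hC1co12 : ∀ (x : MemberY θ.d₆ θ.ℓ₆ θ.hd' θ.hL' θ.b₀ θ.b₁ Mstar) (U : (bg9YR (Matrix (Fin N) (Fin N) ℂ) (specialUnitaryUnits (Fin N)) R₁ R₂ x).Cfg), (𝔬12 x).C1 U = C1coKq x.toKIdx (trBasis N) (bg9YR (Matrix (Fin N) (Fin N) ℂ) (specialUnitaryUnits (Fin N)) R₁ R₂ x) (fun U => U) (𝔮 x.toKIdx) (𝔮s x.toKIdx) (parS x.toKIdx) (GpPhysY x.toKIdx (parS x.toKIdx)) (Δ2 x) U)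
    -- [CASCADE-K] LAW: `C₁(U)` is its own counting transpose on the member classes (3.35)–(3.36) (today: dag-n06-w5 `isTransposePair_C1coK` + def-Y `G1Y_GpPhysY_isSymmTr_parSymY`; knit: the adjoint law of the knit pair + G₁ symmetric at `parKnitY`)
    (hC1T : ∀ x : MemberY θ.d₆ θ.ℓ₆ θ.hd' θ.hL' θ.b₀ θ.b₁ Mstar, M12 ≤ (geo9Y x).M → ∀ α₀ : ℝ, 0 < α₀ → (geo9Y x).M * α₀ ≤ a12 → ∀ U : (bg9YR (Matrix (Fin N) (Fin N) ℂ) (specialUnitaryUnits (Fin N)) R₁ R₂ x).Cfg, (bg9YR (Matrix (Fin N) (Fin N) ℂ) (specialUnitaryUnits (Fin N)) R₁ R₂ x).Reg335 c α₀ U → (bg9YR (Matrix (Fin N) (Fin N) ℂ) (specialUnitaryUnits (Fin N)) R₁ R₂ x).Reg336 c α₀ U → IsTransposePair ((𝔬12 x).C1 U) ((𝔬12 x).C1 U))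
    (hG0e : ∀ x : MemberY θ.d₆ θ.ℓ₆ θ.hd' θ.hL' θ.b₀ θ.b₁ Mstar, M12 ≤ (geo9Y x).M → ∀ α₀ : ℝ, 0 < α₀ → (geo9Y x).M * α₀ ≤ a12 → ∀ U : (bg9YR (Matrix (Fin N) (Fin N) ℂ) (specialUnitaryUnits (Fin N)) R₁ R₂ x).Cfg, (bg9YR (Matrix (Fin N) (Fin N) ℂ) (specialUnitaryUnits (Fin N)) R₁ R₂ x).Reg335 c α₀ U → (bg9YR (Matrix (Fin N) (Fin N) ℂ) (specialUnitaryUnits (Fin N)) R₁ R₂ x).Reg336 c α₀ U → Thm33G0 (𝔬12 x) 1 (H12 x) B12₀ δ12₀ U)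
    (hδ₃₀ : δ12₃ ≤ δ12₀)
    -- [CASCADE-K] ROW 26 AS THE KNIT CERTIFICATE DISPLAYS IT (`…KnitPairKA`'s `s3132K` verbatim with `𝔒` for the instance)
    (h26 : B9.Stmt3132Printed (θ.d₆ + 1) c geo9Y (bg9YR (Matrix (Fin N) (Fin N) ℂ) (specialUnitaryUnits (Fin N)) R₁ R₂) (fun x => siteKernelR R₁ R₂ (𝔒 x).QGQinv) (fun x => siteKernelR R₁ R₂ (𝔒 x).QG1Qinv))
    -- [CASCADE-K] LAW: THE AVERAGING LETTER's `Q`-LETTERS AT THE MemberY θ.d₆ θ.ℓ₆ θ.hd' θ.hL' θ.b₀ θ.b₁ MstarBER (v1.7: the pin `hQco12 : Q = QcoKH … parBY` + the (2.60) numerics `hM12q hB12₃q` through dag-n06-w5's `hasMaj_Q_of_pins`; knit: dag-n06-c's (L7) sizes)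
    (BQp : ℝ) (hBQp : 0 ≤ BQp) (hqK : ∀ x : MemberY θ.d₆ θ.ℓ₆ θ.hd' θ.hL' θ.b₀ θ.b₁ Mstar, M12 ≤ (geo9Y x).M → ∀ α₀ : ℝ, 0 < α₀ → (geo9Y x).M * α₀ ≤ a12 → ∀ U : (bg9YR (Matrix (Fin N) (Fin N) ℂ) (specialUnitaryUnits (Fin N)) R₁ R₂ x).Cfg, (bg9YR (Matrix (Fin N) (Fin N) ℂ) (specialUnitaryUnits (Fin N)) R₁ R₂ x).Reg335 c α₀ U →
      ∀ p : ℕ, p ≤ 2 → HasMaj (cNorm 1 (H12 x) (𝔬12 x).blk (fun y => (geo9Y_len_pos x y).le) p) (cNorm 1 (H12 x) (𝔬12 x).blkZ (fun y => (geo9Y_len_pos x y).le) p) ((𝔬12 x).Q U) (fun a b => BQp * Real.exp (-(δ12₃ * (geo9Y x).dist a b))))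
    -- [CASCADE-K] LAW: THE AVERAGING LETTER's `Q⋆`-MAJORANT AT THE MemberY θ.d₆ θ.ℓ₆ θ.hd' θ.hL' θ.b₀ θ.b₁ MstarBER (v1.7: the pin `hQsco12 : Q⋆ = QscoKH … parBY` through w5's `gQs2_pinsB ∕ dgQs_pinsB`; the law of `…N06G0QstarLettersLegAtPinsPUPar`, same shape)
    (BQ δQ : ℝ) (hBQ : 0 ≤ BQ) (hδQ : δ12₃ + σ12 ≤ δQ) (hqsK : ∀ x : MemberY θ.d₆ θ.ℓ₆ θ.hd' θ.hL' θ.b₀ θ.b₁ Mstar, M12 ≤ (geo9Y x).M → ∀ α₀ : ℝ, 0 < α₀ → (geo9Y x).M * α₀ ≤ a12 → ∀ U : (bg9YR (Matrix (Fin N) (Fin N) ℂ) (specialUnitaryUnits (Fin N)) R₁ R₂ x).Cfg, (bg9YR (Matrix (Fin N) (Fin N) ℂ) (specialUnitaryUnits (Fin N)) R₁ R₂ x).Reg335 c α₀ U →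
      HasMaj (weightNorm (BlockNorm.ofBlocks (toB6 (geo9Y x) 1 (H12 x)) (𝔬12 x).blkZ) (fun y => ((((θ.ℓ₆ + 1 : ℕ) : ℝ) ^ (θ.d₆ + 1)) ^ lvl x.hN x.D x.hk y)⁻¹) (fun y => (plateau_pos x.toKIdx y).le)) (cNorm 1 (H12 x) (𝔬12 x).blk (fun y => (geo9Y_len_pos x y).le) 0) ((𝔬12 x).Qstar U) (fun a a' => BQ * Real.exp (-(δQ * (geo9Y x).dist a a'))))
    -- the letter `rgd2` (R∇\*_UG₁ : 𝔠⁽⁰⁾ → 𝔠_W⁽¹⁾) DERIVED by the certificate (dag-n06-l `…N06Rgd2LegAtPinsPhysPU.hrgd2_of_pinsP_geo9Y` + its own `Ids3152`), no longer displayed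
    (hrgd2_13 : ∀ x : MemberY θ.d₆ θ.ℓ₆ θ.hd' θ.hL' θ.b₀ θ.b₁ Mstar, M12 ≤ (geo9Y x).M → ∀ α₀ : ℝ, 0 < α₀ → (geo9Y x).M * α₀ ≤ a12 → ∀ U : (bg9YR (Matrix (Fin N) (Fin N) ℂ) (specialUnitaryUnits (Fin N)) R₁ R₂ x).Cfg, (bg9YR (Matrix (Fin N) (Fin N) ℂ) (specialUnitaryUnits (Fin N)) R₁ R₂ x).Reg335 c α₀ U → (bg9YR (Matrix (Fin N) (Fin N) ℂ) (specialUnitaryUnits (Fin N)) R₁ R₂ x).Reg336 c α₀ U →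
        HasMaj (cNorm 1 (H12 x) (𝔬12 x).blk (fun y => (geo9Y_len_pos x y).le) 0) (cNorm 1 (H12 x) (𝔬12 x).blkW (fun y => (geo9Y_len_pos x y).le) 1) ((𝔬12 x).R U ∘ₗ (𝔬12 x).Dvstar U ∘ₗ (𝔬12 x).G1 U ∘ₗ LinearMap.id) (fun a b => B12₃ * Real.exp (-(δ12₃ * (geo9Y x).dist a b))))
    (hwGp13 : ∀ x : MemberY θ.d₆ θ.ℓ₆ θ.hd' θ.hL' θ.b₀ θ.b₁ Mstar, M12 ≤ (geo9Y x).M → ∀ α₀ : ℝ, 0 < α₀ → (geo9Y x).M * α₀ ≤ a12 → ∀ U : (bg9YR (Matrix (Fin N) (Fin N) ℂ) (specialUnitaryUnits (Fin N)) R₁ R₂ x).Cfg, (bg9YR (Matrix (Fin N) (Fin N) ℂ) (specialUnitaryUnits (Fin N)) R₁ R₂ x).Reg335 c α₀ U → (bg9YR (Matrix (Fin N) (Fin N) ℂ) (specialUnitaryUnits (Fin N)) R₁ R₂ x).Reg336 c α₀ U →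
        HasMaj (bXH x U) (cNorm 1 (H12 x) (𝔬12 x).blk (fun y => (geo9Y_len_pos x y).le) 1) ((𝔬12 x).Dv U ∘ₗ Gp x U ∘ₗ (𝔬12 x).R U ∘ₗ (𝔬12 x).Dvstar U) (fun a b => B12₃ * Real.exp (-(δ12₃ * (geo9Y x).dist a b))))
    (h152 : ∀ x : MemberY θ.d₆ θ.ℓ₆ θ.hd' θ.hL' θ.b₀ θ.b₁ Mstar, M12 ≤ (geo9Y x).M → ∀ α₀ : ℝ, 0 < α₀ → (geo9Y x).M * α₀ ≤ a12 → ∀ U : (bg9YR (Matrix (Fin N) (Fin N) ℂ) (specialUnitaryUnits (Fin N)) R₁ R₂ x).Cfg, (bg9YR (Matrix (Fin N) (Fin N) ℂ) (specialUnitaryUnits (Fin N)) R₁ R₂ x).Reg335 c α₀ U → (bg9YR (Matrix (Fin N) (Fin N) ℂ) (specialUnitaryUnits (Fin N)) R₁ R₂ x).Reg336 c α₀ U → Ids3152 (𝔬12 x) (Gp x) U)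
    (hrgdH13 : ∀ x : MemberY θ.d₆ θ.ℓ₆ θ.hd' θ.hL' θ.b₀ θ.b₁ Mstar, M12 ≤ (geo9Y x).M → ∀ α₀ : ℝ, 0 < α₀ → (geo9Y x).M * α₀ ≤ a12 → ∀ U : (bg9YR (Matrix (Fin N) (Fin N) ℂ) (specialUnitaryUnits (Fin N)) R₁ R₂ x).Cfg, (bg9YR (Matrix (Fin N) (Fin N) ℂ) (specialUnitaryUnits (Fin N)) R₁ R₂ x).Reg335 c α₀ U → (bg9YR (Matrix (Fin N) (Fin N) ℂ) (specialUnitaryUnits (Fin N)) R₁ R₂ x).Reg336 c α₀ U → HasMaj (cNorm 1 (H12 x) (𝔬12 x).blk (fun y => (geo9Y_len_pos x y).le) 0) (bH13 x U) ((𝔬12 x).R U ∘ₗ (𝔬12 x).Dvstar U ∘ₗ (𝔬12 x).G1 U ∘ₗ LinearMap.id) (fun a b => B12₃ * Real.exp (-(δ12₃ * (geo9Y x).dist a b))))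
    (hdgDH13 : ∀ x : MemberY θ.d₆ θ.ℓ₆ θ.hd' θ.hL' θ.b₀ θ.b₁ Mstar, M12 ≤ (geo9Y x).M → ∀ α₀ : ℝ, 0 < α₀ → (geo9Y x).M * α₀ ≤ a12 → ∀ U : (bg9YR (Matrix (Fin N) (Fin N) ℂ) (specialUnitaryUnits (Fin N)) R₁ R₂ x).Cfg, (bg9YR (Matrix (Fin N) (Fin N) ℂ) (specialUnitaryUnits (Fin N)) R₁ R₂ x).Reg335 c α₀ U → (bg9YR (Matrix (Fin N) (Fin N) ℂ) (specialUnitaryUnits (Fin N)) R₁ R₂ x).Reg336 c α₀ U → HasMaj (bH13 x U) (cNorm 1 (H12 x) (𝔬12 x).blkY (fun y => (geo9Y_len_pos x y).le) 1) ((𝔬12 x).D U ∘ₗ (𝔬12 x).G0 U ∘ₗ (𝔬12 x).Dv U) (fun a b => B12₃ * Real.exp (-(δ12₃ * (geo9Y x).dist a b))))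
    (hlettersDM13 : ∀ x : MemberY θ.d₆ θ.ℓ₆ θ.hd' θ.hL' θ.b₀ θ.b₁ Mstar, M12 ≤ (geo9Y x).M → ∀ α₀ : ℝ, 0 < α₀ → (geo9Y x).M * α₀ ≤ a12 → ∀ U : (bg9YR (Matrix (Fin N) (Fin N) ℂ) (specialUnitaryUnits (Fin N)) R₁ R₂ x).Cfg, (bg9YR (Matrix (Fin N) (Fin N) ℂ) (specialUnitaryUnits (Fin N)) R₁ R₂ x).Reg335 c α₀ U → (bg9YR (Matrix (Fin N) (Fin N) ℂ) (specialUnitaryUnits (Fin N)) R₁ R₂ x).Reg336 c α₀ U → Letters313DMZ (𝔬12 x) (𝔭A x) (Dd x) 1 (H12 x) ⟨geo9Y_dist_triangle x, geo9Y_dist_comm x, geo9K_dist_nonneg x.toKIdx, geo9Y_len_pos x⟩ (fun y => ((((θ.ℓ₆ + 1 : ℕ) : ℝ) ^ (θ.d₆ + 1)) ^ lvl x.hN x.D x.hk y)⁻¹) (fun y => plateau_pos x.toKIdx y) B12₃ Bq12 δ12₃ (bH13 x U) U)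
    -- U8 (director-ym №272 (5)): the regular state classes' letters, the (3.43) homogeneous majorant, the ℓ¹ input controls (№285 (R-b)) and the four STATE TUPLES replacing the raw Δ⁽²⁾ letters
    (θS κS A₀S AW AQ AD AQ1 CR δP : ℝ) (AI AV : ℝ → ℝ) (hθS : 0 ≤ θS) (hκS : 1 ≤ κS) (hκ13S : κ13 ≤ κS) (hA₀S : 0 ≤ A₀S) (hAW : 0 ≤ AW) (hAQ : 0 ≤ AQ) (hAD : 0 ≤ AD) (hADB12 : 2 * AD ≤ B12₃) (hAQ1 : 0 ≤ AQ1) (hCR : 0 ≤ CR)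
    (hAI : ∀ ε, 0 < ε → 0 ≤ AI ε) (hAV : ∀ ε, 0 < ε → 0 ≤ AV ε) (hρP12 : ρ12 + 2 * σ12 ≤ δP) (hδP₀ : δP ≤ δ12₀) (hδP₃ : δP ≤ δ12₃)
    (he1 : ∀ x : MemberY θ.d₆ θ.ℓ₆ θ.hd' θ.hL' θ.b₀ θ.b₁ Mstar, M12 ≤ (geo9Y x).M → ∀ α₀ : ℝ, 0 < α₀ → (geo9Y x).M * α₀ ≤ a12 → ∀ U : (bg9YR (Matrix (Fin N) (Fin N) ℂ) (specialUnitaryUnits (Fin N)) R₁ R₂ x).Cfg, (bg9YR (Matrix (Fin N) (Fin N) ℂ) (specialUnitaryUnits (Fin N)) R₁ R₂ x).Reg335 c α₀ U → (bg9YR (Matrix (Fin N) (Fin N) ℂ) (specialUnitaryUnits (Fin N)) R₁ R₂ x).Reg336 c α₀ U →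
  HasMajorantHom (g := toB6 (geo9Y x) 1 (H12 x)) (𝔬12 x).blk (𝔬12 x).blkY ((𝔬12 x).D U ∘ₗ (𝔬12 x).G0 U)
          (fun (a b : (geo9Y x).Site) => B12₀ * (geo9Y x).len a * Real.exp (-(δ12₀ * (geo9Y x).dist a b))))
    (hdomX : ∀ (x : MemberY θ.d₆ θ.ℓ₆ θ.hd' θ.hL' θ.b₀ θ.b₁ Mstar) (ε : ℝ), 0 < ε → ∃ ΛX : ℝ, 0 ≤ ΛX ∧
      ∀ (y : (geo9Y x).Site) (μ : XBK (TrIdx N) x.toKIdx → ℝ), (bHX12 x ε).IsLoc y μ → ∑ q : XBK (TrIdx N) x.toKIdx, |μ q| ≤ ΛX * (bHX12 x ε).loc y μ)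
    (hdomW : ∀ (x : MemberY θ.d₆ θ.ℓ₆ θ.hd' θ.hL' θ.b₀ θ.b₁ Mstar) (U : (bg9YR (Matrix (Fin N) (Fin N) ℂ) (specialUnitaryUnits (Fin N)) R₁ R₂ x).Cfg) (ε : ℝ), 0 < ε → ∃ ΛW : ℝ, 0 ≤ ΛW ∧
      ∀ (y : (geo9Y x).Site) (μ : W12 x → ℝ), (bHW13 x U ε).IsLoc y μ → ∑ w : W12 x, |μ w| ≤ ΛW * (bHW13 x U ε).loc y μ)
    (hst20 : ∀ x : MemberY θ.d₆ θ.ℓ₆ θ.hd' θ.hL' θ.b₀ θ.b₁ Mstar, M12 ≤ (geo9Y x).M → ∀ α₀ : ℝ, 0 < α₀ → (geo9Y x).M * α₀ ≤ a12 → ∀ U : (bg9YR (Matrix (Fin N) (Fin N) ℂ) (specialUnitaryUnits (Fin N)) R₁ R₂ x).Cfg, (bg9YR (Matrix (Fin N) (Fin N) ℂ) (specialUnitaryUnits (Fin N)) R₁ R₂ x).Reg335 c α₀ U → (bg9YR (Matrix (Fin N) (Fin N) ℂ) (specialUnitaryUnits (Fin N)) R₁ R₂ x).Reg336 c α₀ U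 →
        (StepS (𝔬12 x) (weightNorm (bXH x U) (rwt (geo9Y x) (-1)) (rwt_nonneg (fun y => (geo9Y_len_pos x y).le) (-1))) (θS * ((geo9Y x).M * α₀)) δK12 U ∧
          (HasMaj (weightNorm (bXH x U) (rwt (geo9Y x) (-1)) (rwt_nonneg (fun y => (geo9Y_len_pos x y).le) (-1))) (cNorm 1 (H12 x) (𝔬12 x).blkY (fun y => (geo9Y_len_pos x y).le) 1) ((𝔬12 x).D U ∘ₗ (𝔬12 x).G0 U ∘ₗ (𝔬12 x).Tpi U) (fun a b => θD12 * ((geo9Y x).M * α₀) * Real.exp (-(δK12 * (geo9Y x).dist a b))) ∧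
            HasMaj (weightNorm (bXH x U) (rwt (geo9Y x) (-1)) (rwt_nonneg (fun y => (geo9Y_len_pos x y).le) (-1))) (cNorm 1 (H12 x) (𝔬12 x).blkY (fun y => (geo9Y_len_pos x y).le) 1) ((𝔬12 x).D U ∘ₗ (𝔬12 x).G0 U ∘ₗ ((𝔬12 x).Tpi U + (𝔬12 x).T2 U)) (fun a b => θD12 * ((geo9Y x).M * α₀) * Real.exp (-(δK12 * (geo9Y x).dist a b)))) ∧
          (∀ β : ℝ, 0 ≤ β → β < 1 →
            HasMaj (weightNorm (bXH x U) (rwt (geo9Y x) (-1)) (rwt_nonneg (fun y => (geo9Y_len_pos x y).le) (-1))) (cNormR 1 (H12 x) (𝔭A x).blkPY (fun y => (geo9Y_len_pos x y).le) (β - 1)) (((𝔭A x).ΦY U β ∘ₗ (𝔬12 x).D U ∘ₗ (𝔬12 x).G0 U) ∘ₗ (𝔬12 x).Tpi U) (fun a b => θH12 β * ((geo9Y x).M * α₀) * Real.exp (-(δK12 * (geo9Y x).dist a b))) ∧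
            HasMaj (weightNorm (bXH x U) (rwt (geo9Y x) (-1)) (rwt_nonneg (fun y => (geo9Y_len_pos x y).le) (-1))) (cNormR 1 (H12 x) (𝔭A x).blkPY (fun y => (geo9Y_len_pos x y).le) (β - 1)) (((𝔭A x).ΦY U β ∘ₗ (𝔬12 x).D U ∘ₗ (𝔬12 x).G0 U) ∘ₗ ((𝔬12 x).Tpi U + (𝔬12 x).T2 U)) (fun a b => θH12 β * ((geo9Y x).M * α₀) * Real.exp (-(δK12 * (geo9Y x).dist a b)))) ∧
          HasMaj (cNorm 1 (H12 x) (𝔬12 x).blk (fun y => (geo9Y_len_pos x y).le) 0) (weightNorm (bXH x U) (rwt (geo9Y x) (-1)) (rwt_nonneg (fun y => (geo9Y_len_pos x y).le) (-1))) ((𝔬12 x).G0 U) (fun a b => A₀S * Real.exp (-(δP * (geo9Y x).dist a b))) ∧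
          HasMaj (weightNorm (BlockNorm.ofBlocks (toB6 (geo9Y x) 1 (H12 x)) (𝔬12 x).blkZ) (fun y => ((((θ.ℓ₆ + 1 : ℕ) : ℝ) ^ (θ.d₆ + 1)) ^ lvl x.hN x.D x.hk y)⁻¹) (fun y => (plateau_pos x.toKIdx y).le)) (weightNorm (bXH x U) (rwt (geo9Y x) (-1)) (rwt_nonneg (fun y => (geo9Y_len_pos x y).le) (-1))) ((𝔬12 x).G0 U ∘ₗ (𝔬12 x).Qstar U) (fun a b => AQ * Real.exp (-(δP * (geo9Y x).dist a b))) ∧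
          HasMaj (weightNorm (bXH x U) (rwt (geo9Y x) (-1)) (rwt_nonneg (fun y => (geo9Y_len_pos x y).le) (-1))) (cNormR 1 (H12 x) (𝔬12 x).blk (fun y => (geo9Y_len_pos x y).le) (-2)) LinearMap.id (fun a b => CR * Real.exp (-(δP * (geo9Y x).dist a b))) ∧
          (weightNorm (bXH x U) (rwt (geo9Y x) (-1)) (rwt_nonneg (fun y => (geo9Y_len_pos x y).le) (-1))).κ ≤ κS ∧
          (∃ Λ : ℝ, 0 ≤ Λ ∧ ∀ (y : (geo9Y x).Site) (F : XBK (TrIdx N) x.toKIdx → ℝ), (weightNorm (bXH x U) (rwt (geo9Y x) (-1)) (rwt_nonneg (fun y => (geo9Y_len_pos x y).le) (-1))).loc y F ≤ Λ * ∑ q : XBK (TrIdx N) x.toKIdx, |F q|)))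
    (hst10 : ∀ x : MemberY θ.d₆ θ.ℓ₆ θ.hd' θ.hL' θ.b₀ θ.b₁ Mstar, M12 ≤ (geo9Y x).M → ∀ α₀ : ℝ, 0 < α₀ → (geo9Y x).M * α₀ ≤ a12 → ∀ U : (bg9YR (Matrix (Fin N) (Fin N) ℂ) (specialUnitaryUnits (Fin N)) R₁ R₂ x).Cfg, (bg9YR (Matrix (Fin N) (Fin N) ℂ) (specialUnitaryUnits (Fin N)) R₁ R₂ x).Reg335 c α₀ U → (bg9YR (Matrix (Fin N) (Fin N) ℂ) (specialUnitaryUnits (Fin N)) R₁ R₂ x).Reg336 c α₀ U →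
        (StepS (𝔬12 x) (bXH x U) (θS * ((geo9Y x).M * α₀)) δK12 U ∧
          (∀ ν : Fin (θ.d₆ + 1),
            HasMaj (bXH x U) (cNormR 1 (H12 x) (𝔬12 x).blk (fun y => (geo9Y_len_pos x y).le) 0) (Dd x U ν ∘ₗ (𝔬12 x).G0 U ∘ₗ (𝔬12 x).Tpi U) (fun a b => θD12 * ((geo9Y x).M * α₀) * Real.exp (-(δK12 * (geo9Y x).dist a b))) ∧
            HasMaj (bXH x U) (cNormR 1 (H12 x) (𝔬12 x).blk (fun y => (geo9Y_len_pos x y).le) 0) (Dd x U ν ∘ₗ (𝔬12 x).G0 U ∘ₗ ((𝔬12 x).Tpi U + (𝔬12 x).T2 U)) (fun a b => θD12 * ((geo9Y x).M * α₀) * Real.exp (-(δK12 * (geo9Y x).dist a b)))) ∧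
          (∀ β : ℝ, 0 ≤ β → β < 1 →
            HasMaj (bXH x U) (cNormR 1 (H12 x) (𝔭A x).blkPX (fun y => (geo9Y_len_pos x y).le) (β - 1)) (((𝔭A x).ΦX U β ∘ₗ (𝔬12 x).G0 U) ∘ₗ (𝔬12 x).Tpi U) (fun a b => θH12 β * ((geo9Y x).M * α₀) * Real.exp (-(δK12 * (geo9Y x).dist a b))) ∧
            HasMaj (bXH x U) (cNormR 1 (H12 x) (𝔭A x).blkPX (fun y => (geo9Y_len_pos x y).le) (β - 1)) (((𝔭A x).ΦX U β ∘ₗ (𝔬12 x).G0 U) ∘ₗ ((𝔬12 x).Tpi U + (𝔬12 x).T2 U)) (fun a b => θH12 β * ((geo9Y x).M * α₀) * Real.exp (-(δK12 * (geo9Y x).dist a b)))) ∧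
          (∀ (ν : Fin (θ.d₆ + 1)) (β : ℝ), 0 ≤ β → β < 1 →
            HasMaj (bXH x U) (cNormR 1 (H12 x) (𝔭A x).blkPX (fun y => (geo9Y_len_pos x y).le) β) (((𝔭A x).ΦX U β ∘ₗ Dd x U ν ∘ₗ (𝔬12 x).G0 U) ∘ₗ (𝔬12 x).Tpi U) (fun a b => θH12 β * ((geo9Y x).M * α₀) * Real.exp (-(δK12 * (geo9Y x).dist a b))) ∧
            HasMaj (bXH x U) (cNormR 1 (H12 x) (𝔭A x).blkPX (fun y => (geo9Y_len_pos x y).le) β) (((𝔭A x).ΦX U β ∘ₗ Dd x U ν ∘ₗ (𝔬12 x).G0 U) ∘ₗ ((𝔬12 x).Tpi U + (𝔬12 x).T2 U)) (fun a b => θH12 β * ((geo9Y x).M * α₀) * Real.exp (-(δK12 * (geo9Y x).dist a b)))) ∧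
          HasMaj (cNormR 1 (H12 x) (𝔬12 x).blkY (fun y => (geo9Y_len_pos x y).le) 0) (bXH x U) ((𝔬12 x).G0 U ∘ₗ (𝔬12 x).Dstar U) (fun a b => AD * Real.exp (-(δP * (geo9Y x).dist a b))) ∧
          (∀ (μ : Fin (θ.d₆ + 1)) (ε : ℝ), 0 < ε → HasMaj (bHX12 x ε) (bXH x U) ((𝔬12 x).G0 U ∘ₗ Dds x U μ) (fun a b => AI ε * Real.exp (-(δP * (geo9Y x).dist a b)))) ∧
          HasMaj (bXH x U) (cNormR 1 (H12 x) (𝔬12 x).blk (fun y => (geo9Y_len_pos x y).le) (-1)) LinearMap.id (fun a b => CR * Real.exp (-(δP * (geo9Y x).dist a b))) ∧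
          (bXH x U).κ ≤ κS ∧
          (∃ Λ : ℝ, 0 ≤ Λ ∧ ∀ (y : (geo9Y x).Site) (F : XBK (TrIdx N) x.toKIdx → ℝ), (bXH x U).loc y F ≤ Λ * ∑ q : XBK (TrIdx N) x.toKIdx, |F q|)))
    (hst21 : ∀ x : MemberY θ.d₆ θ.ℓ₆ θ.hd' θ.hL' θ.b₀ θ.b₁ Mstar, M12 ≤ (geo9Y x).M → ∀ α₀ : ℝ, 0 < α₀ → (geo9Y x).M * α₀ ≤ a12 → ∀ U : (bg9YR (Matrix (Fin N) (Fin N) ℂ) (specialUnitaryUnits (Fin N)) R₁ R₂ x).Cfg, (bg9YR (Matrix (Fin N) (Fin N) ℂ) (specialUnitaryUnits (Fin N)) R₁ R₂ x).Reg335 c α₀ U → (bg9YR (Matrix (Fin N) (Fin N) ℂ) (specialUnitaryUnits (Fin N)) R₁ R₂ x).Reg336 c α₀ U →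
        (StepS (𝔬12 x) (weightNorm (bXH x U) (rwt (geo9Y x) (-1)) (rwt_nonneg (fun y => (geo9Y_len_pos x y).le) (-1))) (θS * ((geo9Y x).M * α₀)) δK12 U ∧
          HasMaj (weightNorm (bXH x U) (rwt (geo9Y x) (-1)) (rwt_nonneg (fun y => (geo9Y_len_pos x y).le) (-1))) (cNorm 1 (H12 x) (𝔬12 x).blkY (fun y => (geo9Y_len_pos x y).le) 1) ((𝔬12 x).D U ∘ₗ (𝔬12 x).G0 U ∘ₗ ((𝔬12 x).Tpi U + (𝔬12 x).T2 U)) (fun a b => θD12 * ((geo9Y x).M * α₀) * Real.exp (-(δK12 * (geo9Y x).dist a b))) ∧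
          (∀ ν : Fin (θ.d₆ + 1), HasMaj (weightNorm (bXH x U) (rwt (geo9Y x) (-1)) (rwt_nonneg (fun y => (geo9Y_len_pos x y).le) (-1))) (cNorm 1 (H12 x) (𝔬12 x).blk (fun y => (geo9Y_len_pos x y).le) 1) (Dd x U ν ∘ₗ (𝔬12 x).G0 U ∘ₗ ((𝔬12 x).Tpi U + (𝔬12 x).T2 U)) (fun a b => θD12 * ((geo9Y x).M * α₀) * Real.exp (-(δK12 * (geo9Y x).dist a b)))) ∧
          (∀ β : ℝ, 0 ≤ β → β < 1 → HasMaj (weightNorm (bXH x U) (rwt (geo9Y x) (-1)) (rwt_nonneg (fun y => (geo9Y_len_pos x y).le) (-1))) (cNormR 1 (H12 x) (𝔭A x).blkPY (fun y => (geo9Y_len_pos x y).le) (β - 1)) (((𝔭A x).ΦY U β ∘ₗ (𝔬12 x).D U ∘ₗ (𝔬12 x).G0 U) ∘ₗ ((𝔬12 x).Tpi U + (𝔬12 x).T2 U)) (fun a b => θH12 β * ((geo9Y x).M * α₀) * Real.exp (-(δK12 * (geo9Y x).dist a b)))) ∧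
          (∀ (ν : Fin (θ.d₆ + 1)) (β : ℝ), 0 ≤ β → β < 1 → HasMaj (weightNorm (bXH x U) (rwt (geo9Y x) (-1)) (rwt_nonneg (fun y => (geo9Y_len_pos x y).le) (-1))) (cNormR 1 (H12 x) (𝔭A x).blkPX (fun y => (geo9Y_len_pos x y).le) (β - 1)) (((𝔭A x).ΦX U β ∘ₗ Dd x U ν ∘ₗ (𝔬12 x).G0 U) ∘ₗ ((𝔬12 x).Tpi U + (𝔬12 x).T2 U)) (fun a b => θH12 β * ((geo9Y x).M * α₀) * Real.exp (-(δK12 * (geo9Y x).dist a b)))) ∧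
          HasMaj (cNorm 1 (H12 x) (𝔬12 x).blk (fun y => (geo9Y_len_pos x y).le) 0) (weightNorm (bXH x U) (rwt (geo9Y x) (-1)) (rwt_nonneg (fun y => (geo9Y_len_pos x y).le) (-1))) ((𝔬12 x).G0 U) (fun a b => A₀S * Real.exp (-(δP * (geo9Y x).dist a b))) ∧
          HasMaj (cNorm 1 (H12 x) (𝔬12 x).blkW (fun y => (geo9Y_len_pos x y).le) 1) (weightNorm (bXH x U) (rwt (geo9Y x) (-1)) (rwt_nonneg (fun y => (geo9Y_len_pos x y).le) (-1))) ((𝔬12 x).G0 U ∘ₗ (𝔬12 x).Dv U) (fun a b => AW * Real.exp (-(δP * (geo9Y x).dist a b))) ∧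
          HasMaj (weightNorm (BlockNorm.ofBlocks (toB6 (geo9Y x) 1 (H12 x)) (𝔬12 x).blkZ) (fun y => ((((θ.ℓ₆ + 1 : ℕ) : ℝ) ^ (θ.d₆ + 1)) ^ lvl x.hN x.D x.hk y)⁻¹) (fun y => (plateau_pos x.toKIdx y).le)) (weightNorm (bXH x U) (rwt (geo9Y x) (-1)) (rwt_nonneg (fun y => (geo9Y_len_pos x y).le) (-1))) ((𝔬12 x).G0 U ∘ₗ (𝔬12 x).Qstar U) (fun a b => AQ * Real.exp (-(δP * (geo9Y x).dist a b))) ∧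
          HasMaj (weightNorm (bXH x U) (rwt (geo9Y x) (-1)) (rwt_nonneg (fun y => (geo9Y_len_pos x y).le) (-1))) (cNormR 1 (H12 x) (𝔬12 x).blk (fun y => (geo9Y_len_pos x y).le) (-2)) LinearMap.id (fun a b => CR * Real.exp (-(δP * (geo9Y x).dist a b))) ∧
          (∃ Λ : ℝ, 0 ≤ Λ ∧ ∀ (y : (geo9Y x).Site) (F : XBK (TrIdx N) x.toKIdx → ℝ), (weightNorm (bXH x U) (rwt (geo9Y x) (-1)) (rwt_nonneg (fun y => (geo9Y_len_pos x y).le) (-1))).loc y F ≤ Λ * ∑ q : XBK (TrIdx N) x.toKIdx, |F q|)))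
    (hst11 : ∀ x : MemberY θ.d₆ θ.ℓ₆ θ.hd' θ.hL' θ.b₀ θ.b₁ Mstar, M12 ≤ (geo9Y x).M → ∀ α₀ : ℝ, 0 < α₀ → (geo9Y x).M * α₀ ≤ a12 → ∀ U : (bg9YR (Matrix (Fin N) (Fin N) ℂ) (specialUnitaryUnits (Fin N)) R₁ R₂ x).Cfg, (bg9YR (Matrix (Fin N) (Fin N) ℂ) (specialUnitaryUnits (Fin N)) R₁ R₂ x).Reg335 c α₀ U → (bg9YR (Matrix (Fin N) (Fin N) ℂ) (specialUnitaryUnits (Fin N)) R₁ R₂ x).Reg336 c α₀ U →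
        (StepS (𝔬12 x) (bXH x U) (θS * ((geo9Y x).M * α₀)) δK12 U ∧
          (∀ ν : Fin (θ.d₆ + 1), HasMaj (bXH x U) (cNormR 1 (H12 x) (𝔬12 x).blk (fun y => (geo9Y_len_pos x y).le) 0) (Dd x U ν ∘ₗ (𝔬12 x).G0 U ∘ₗ ((𝔬12 x).Tpi U + (𝔬12 x).T2 U)) (fun a b => θD12 * ((geo9Y x).M * α₀) * Real.exp (-(δK12 * (geo9Y x).dist a b)))) ∧
          (∀ β : ℝ, 0 ≤ β → β < 1 → HasMaj (bXH x U) (cNormR 1 (H12 x) (𝔭A x).blkPX (fun y => (geo9Y_len_pos x y).le) (β - 1)) (((𝔭A x).ΦX U β ∘ₗ (𝔬12 x).G0 U) ∘ₗ ((𝔬12 x).Tpi U + (𝔬12 x).T2 U)) (fun a b => θH12 β * ((geo9Y x).M * α₀) * Real.exp (-(δK12 * (geo9Y x).dist a b)))) ∧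
          (∀ (ν : Fin (θ.d₆ + 1)) (β : ℝ), 0 ≤ β → β < 1 → HasMaj (bXH x U) (cNormR 1 (H12 x) (𝔭A x).blkPX (fun y => (geo9Y_len_pos x y).le) β) (((𝔭A x).ΦX U β ∘ₗ Dd x U ν ∘ₗ (𝔬12 x).G0 U) ∘ₗ ((𝔬12 x).Tpi U + (𝔬12 x).T2 U)) (fun a b => θH12 β * ((geo9Y x).M * α₀) * Real.exp (-(δK12 * (geo9Y x).dist a b)))) ∧
          HasMaj (cNormR 1 (H12 x) (𝔬12 x).blkY (fun y => (geo9Y_len_pos x y).le) 0) (bXH x U) ((𝔬12 x).G0 U ∘ₗ (𝔬12 x).Dstar U) (fun a b => AD * Real.exp (-(δP * (geo9Y x).dist a b))) ∧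
          (∀ (μ : Fin (θ.d₆ + 1)) (ε : ℝ), 0 < ε → HasMaj (bHX12 x ε) (bXH x U) ((𝔬12 x).G0 U ∘ₗ Dds x U μ) (fun a b => AI ε * Real.exp (-(δP * (geo9Y x).dist a b)))) ∧
          (∀ ε : ℝ, 0 < ε → HasMaj (bHW13 x U ε) (bXH x U) ((𝔬12 x).G0 U ∘ₗ (𝔬12 x).Dv U) (fun a b => AV ε * Real.exp (-(δP * (geo9Y x).dist a b)))) ∧
          HasMaj (weightNorm (BlockNorm.ofBlocks (toB6 (geo9Y x) 1 (H12 x)) (𝔬12 x).blkZ) (fun y => (geo9Y x).len y * ((((θ.ℓ₆ + 1 : ℕ) : ℝ) ^ (θ.d₆ + 1)) ^ lvl x.hN x.D x.hk y)⁻¹) (fun y => (mul_pos (geo9Y_len_pos x y) (plateau_pos x.toKIdx y)).le)) (bXH x U) ((𝔬12 x).G0 U ∘ₗ (𝔬12 x).Qstar U) (fun a b => AQ1 * Real.exp (-(δP * (geo9Y x).dist a b))) ∧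
          HasMaj (bXH x U) (cNormR 1 (H12 x) (𝔬12 x).blk (fun y => (geo9Y_len_pos x y).le) (-1)) LinearMap.id (fun a b => CR * Real.exp (-(δP * (geo9Y x).dist a b))) ∧
          (∃ Λ : ℝ, 0 ≤ Λ ∧ ∀ (y : (geo9Y x).Site) (F : XBK (TrIdx N) x.toKIdx → ℝ), (bXH x U).loc y F ≤ Λ * ∑ q : XBK (TrIdx N) x.toKIdx, |F q|)))
    : B9.Thm312Printed (θ.d₆ + 1) c geo9Y (bg9YR (Matrix (Fin N) (Fin N) ℂ) (specialUnitaryUnits (Fin N)) R₁ R₂) (fun x => kernelFamilyR R₁ R₂ (𝔒 x).GD) (fun x => kernelFamilyR R₁ R₂ (𝔒 x).G₁) (fun x => hKernelR R₁ R₂ (𝔒 x).H) (fun x => hKernelR R₁ R₂ (𝔒 x).H₁)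
        (fun x K => (𝔒 x).HasRWExp (kernelFamilyRY K)) (fun x K => (𝔒 x).HasRWExpH (hKernelRY K)) (fun x K => (𝔒 x).PosDefK (kernelFamilyRY K)) ∧
      B9.Thm313Printed c geo9Y (bg9YR (Matrix (Fin N) (Fin N) ℂ) (specialUnitaryUnits (Fin N)) R₁ R₂) (fun x => kernelFamilyR R₁ R₂ (𝔒 x).GG) (fun x K => (𝔒 x).HasRWExp (kernelFamilyRY K)) (fun x K => (𝔒 x).PosDefK (kernelFamilyRY K)) := by
  have hL1 : (1 : ℝ) ≤ ((θ.ℓ₆ + 1 : ℕ) : ℝ) := by exact_mod_cast Nat.succ_le_succ (Nat.zero_le _)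
  have hsat : ∀ (x : MemberY θ.d₆ θ.ℓ₆ θ.hd' θ.hL' θ.b₀ θ.b₁ Mstar) (n : Fin 4) (B' δ' : ℝ),
      (∀ a a' b, RelB x.toKIdx a a' → maj342 (geo9Y x) n B' δ' a b = maj342 (geo9Y x) n B' δ' a' b) ∧
      (∀ a b b', RelB x.toKIdx b b' → maj342 (geo9Y x) n B' δ' a b = maj342 (geo9Y x) n B' δ' a b') :=
    fun x n B' δ' => ⟨fun a a' b h => maj342_relB_left x.toKIdx n B' δ' a a' b h, fun a b b' h => maj342_relB_right x.toKIdx n B' δ' a b b' h⟩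
  have hmult : ∀ (x : MemberY θ.d₆ θ.ℓ₆ θ.hd' θ.hL' θ.b₀ θ.b₁ Mstar) (y' : (geo9Y x).Site),
      (Finset.univ.filter (fun y'' : (geo9Y x).Site => RelB x.toKIdx y'' y')).card ≤ 2 * (θ.d₆ + 1) := fun x y' => by
    refine le_trans (Finset.card_le_card fun c hc => ?_) (card_sameCarrier_le_kIdx x.toKIdx y')
    exact Finset.mem_filter.2 ⟨@Finset.mem_univ _ (_) c, (Finset.mem_filter.1 hc).2⟩
  have hRdist : ∀ (x : MemberY θ.d₆ θ.ℓ₆ θ.hd' θ.hL' θ.b₀ θ.b₁ Mstar) (a a' b : (geo9Y x).Site), RelB x.toKIdx a a' → (geo9Y x).dist a b = (geo9Y x).dist a' b :=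
    fun x a a' b h => dist_eq_of_relB x.toKIdx h (relB_refl x.toKIdx b)
  have hRlen : ∀ (x : MemberY θ.d₆ θ.ℓ₆ θ.hd' θ.hL' θ.b₀ θ.b₁ Mstar) (a a' : (geo9Y x).Site), RelB x.toKIdx a a' → (geo9Y x).len a = (geo9Y x).len a' :=
    fun x a a' h => len_eq_of_relB x.toKIdx h
  -- the (3.42)∕(3.47)∕(3.133) co-readings of G_D, G₁, 𝔊, H, H₁ at the pins (`N06CoReadingsOfPins`, `B9CoReadingCoordsH`)
  letI hF : ∀ x : MemberY θ.d₆ θ.ℓ₆ θ.hd' θ.hL' θ.b₀ θ.b₁ Mstar, Fintype (B9GeoNormsKLevelV1.geo9K x.toKIdx).Site := fun x => (inferInstance : Fintype (geo9Y x).Site)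
  have hGD := fun (x : MemberY θ.d₆ θ.ℓ₆ θ.hd' θ.hL' θ.b₀ θ.b₁ Mstar) (U : (bg9YR (Matrix (Fin N) (Fin N) ℂ) (specialUnitaryUnits (Fin N)) R₁ R₂ x).Cfg) => bond_coReadings3_of_pins x.toKIdx (trBasis N) (bg9YR (Matrix (Fin N) (Fin N) ℂ) (specialUnitaryUnits (Fin N)) R₁ R₂ x) (fun U => U) (𝔏 x).GD (𝔏 x).parB U (hβI x) (hlev x) (hblk12 x) (hblkY12 x) (hGco12 x U) (hDco12 x U) (hDsco12 x U)
  have hG1 := fun (x : MemberY θ.d₆ θ.ℓ₆ θ.hd' θ.hL' θ.b₀ θ.b₁ Mstar) (U : (bg9YR (Matrix (Fin N) (Fin N) ℂ) (specialUnitaryUnits (Fin N)) R₁ R₂ x).Cfg) => bond_coReadings3_of_pins x.toKIdx (trBasis N) (bg9YR (Matrix (Fin N) (Fin N) ℂ) (specialUnitaryUnits (Fin N)) R₁ R₂ x) (fun U => U) (𝔏 x).G₁ (𝔏 x).parB U (hβI x) (hlev x) (hblk12 x) (hblkY12 x) (hG1co12 x U) (hDco12 x U) (hDsco12 x U)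
  have hGG := fun (x : MemberY θ.d₆ θ.ℓ₆ θ.hd' θ.hL' θ.b₀ θ.b₁ Mstar) (U : (bg9YR (Matrix (Fin N) (Fin N) ℂ) (specialUnitaryUnits (Fin N)) R₁ R₂ x).Cfg) => bond_coReadings3_of_pins x.toKIdx (trBasis N) (bg9YR (Matrix (Fin N) (Fin N) ℂ) (specialUnitaryUnits (Fin N)) R₁ R₂ x) (fun U => U) (𝔏 x).GG (𝔏 x).parB U (hβI x) (hlev x) (hblk12 x) (hblkY12 x) (hGGco12 x U) (hDco12 x U) (hDsco12 x U)
  have hHH := fun (x : MemberY θ.d₆ θ.ℓ₆ θ.hd' θ.hL' θ.b₀ θ.b₁ Mstar) (U : (bg9YR (Matrix (Fin N) (Fin N) ℂ) (specialUnitaryUnits (Fin N)) R₁ R₂ x).Cfg) => coRealizesHRel_of_pins x.toKIdx (trBasis N) (bg9YR (Matrix (Fin N) (Fin N) ℂ) (specialUnitaryUnits (Fin N)) R₁ R₂ x) (fun U => U) (𝔏 x).H (𝔏 x).parB U (hβI x) (hblk12 x) (hblkY12 x) (hblkZ12 x) (hHm12 x U) (hDco12 x U)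
  have hHH1 := fun (x : MemberY θ.d₆ θ.ℓ₆ θ.hd' θ.hL' θ.b₀ θ.b₁ Mstar) (U : (bg9YR (Matrix (Fin N) (Fin N) ℂ) (specialUnitaryUnits (Fin N)) R₁ R₂ x).Cfg) => coRealizesHRel_of_pins x.toKIdx (trBasis N) (bg9YR (Matrix (Fin N) (Fin N) ℂ) (specialUnitaryUnits (Fin N)) R₁ R₂ x) (fun U => U) (𝔏 x).H₁ (𝔏 x).parB U (hβI x) (hblk12 x) (hblkY12 x) (hblkZ12 x) (hH1m12 x U) (hDco12 x U)
  have hcoHR12 := fun (x : MemberY θ.d₆ θ.ℓ₆ θ.hd' θ.hL' θ.b₀ θ.b₁ Mstar) (U : (bg9YR (Matrix (Fin N) (Fin N) ℂ) (specialUnitaryUnits (Fin N)) R₁ R₂ x).Cfg) => And.intro (hHH x U).1 (And.intro (hHH x U).2 (And.intro (hHH1 x U).1 (hHH1 x U).2))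
  have hcoR12 := fun (x : MemberY θ.d₆ θ.ℓ₆ θ.hd' θ.hL' θ.b₀ θ.b₁ Mstar) (U : (bg9YR (Matrix (Fin N) (Fin N) ℂ) (specialUnitaryUnits (Fin N)) R₁ R₂ x).Cfg) => And.intro (hGD x U).1 (And.intro (hGD x U).2.2.1 (And.intro (hG1 x U).1 (hG1 x U).2.2.1))
  have hco1R12 := fun (x : MemberY θ.d₆ θ.ℓ₆ θ.hd' θ.hL' θ.b₀ θ.b₁ Mstar) (U : (bg9YR (Matrix (Fin N) (Fin N) ℂ) (specialUnitaryUnits (Fin N)) R₁ R₂ x).Cfg) => And.intro (hGD x U).2.1 (hG1 x U).2.1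
  have hcoG12 := fun (x : MemberY θ.d₆ θ.ℓ₆ θ.hd' θ.hL' θ.b₀ θ.b₁ Mstar) (U : (bg9YR (Matrix (Fin N) (Fin N) ℂ) (specialUnitaryUnits (Fin N)) R₁ R₂ x).Cfg) => And.intro (hGD x U).2.2.2.1 (And.intro (hGD x U).2.2.2.2.1 (And.intro (hGD x U).2.2.2.2.2.1 (And.intro (hG1 x U).2.2.2.1 (And.intro (hG1 x U).2.2.2.2.1 (hG1 x U).2.2.2.2.2.1))))
  -- row 20's twelve (3.46) L² readings of G_D, G₁ are THEOREMS on the coordinate models (`bond_l2ReadsNbr3_of_pins` + n06-k `bond_l2ReadsNbr345_of_pins` at the pinned direction letters)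
  have hDL := fun (x : MemberY θ.d₆ θ.ℓ₆ θ.hd' θ.hL' θ.b₀ θ.b₁ Mstar) (U : (bg9YR (Matrix (Fin N) (Fin N) ℂ) (specialUnitaryUnits (Fin N)) R₁ R₂ x).Cfg) => bond_l2ReadsNbr3_of_pins x.toKIdx (trBasis N) (bg9YR (Matrix (Fin N) (Fin N) ℂ) (specialUnitaryUnits (Fin N)) R₁ R₂ x) (fun U => U) (𝔏 x).GD (𝔏 x).parB U (R := (1 : ℝ)) (H := H12 x) (hβI x) (hβ1 x) (hblk12 x) (hblkY12 x) (hGco12 x U) (hDco12 x U) (hDsco12 x U)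
  have hDL3 := fun (x : MemberY θ.d₆ θ.ℓ₆ θ.hd' θ.hL' θ.b₀ θ.b₁ Mstar) (U : (bg9YR (Matrix (Fin N) (Fin N) ℂ) (specialUnitaryUnits (Fin N)) R₁ R₂ x).Cfg) => bond_l2ReadsNbr345_of_pins x.toKIdx (trBasis N) (bg9YR (Matrix (Fin N) (Fin N) ℂ) (specialUnitaryUnits (Fin N)) R₁ R₂ x) (fun U => U) (𝔏 x).GD (𝔏 x).parB U (R := (1 : ℝ)) (H := H12 x) (hβI x) (hβ1 x) (hblk12 x) (hGco12 x U) (hDd x U) (hDds x U)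
  have h1L := fun (x : MemberY θ.d₆ θ.ℓ₆ θ.hd' θ.hL' θ.b₀ θ.b₁ Mstar) (U : (bg9YR (Matrix (Fin N) (Fin N) ℂ) (specialUnitaryUnits (Fin N)) R₁ R₂ x).Cfg) => bond_l2ReadsNbr3_of_pins x.toKIdx (trBasis N) (bg9YR (Matrix (Fin N) (Fin N) ℂ) (specialUnitaryUnits (Fin N)) R₁ R₂ x) (fun U => U) (𝔏 x).G₁ (𝔏 x).parB U (R := (1 : ℝ)) (H := H12 x) (hβI x) (hβ1 x) (hblk12 x) (hblkY12 x) (hG1co12 x U) (hDco12 x U) (hDsco12 x U)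
  have h1L3 := fun (x : MemberY θ.d₆ θ.ℓ₆ θ.hd' θ.hL' θ.b₀ θ.b₁ Mstar) (U : (bg9YR (Matrix (Fin N) (Fin N) ℂ) (specialUnitaryUnits (Fin N)) R₁ R₂ x).Cfg) => bond_l2ReadsNbr345_of_pins x.toKIdx (trBasis N) (bg9YR (Matrix (Fin N) (Fin N) ℂ) (specialUnitaryUnits (Fin N)) R₁ R₂ x) (fun U => U) (𝔏 x).G₁ (𝔏 x).parB U (R := (1 : ℝ)) (H := H12 x) (hβI x) (hβ1 x) (hblk12 x) (hG1co12 x U) (hDd x U) (hDds x U)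
  have hGL := fun (x : MemberY θ.d₆ θ.ℓ₆ θ.hd' θ.hL' θ.b₀ θ.b₁ Mstar) (U : (bg9YR (Matrix (Fin N) (Fin N) ℂ) (specialUnitaryUnits (Fin N)) R₁ R₂ x).Cfg) => bond_l2ReadsNbr3_of_pins x.toKIdx (trBasis N) (bg9YR (Matrix (Fin N) (Fin N) ℂ) (specialUnitaryUnits (Fin N)) R₁ R₂ x) (fun U => U) (𝔏 x).GG (𝔏 x).parB U (R := (1 : ℝ)) (H := H12 x) (hβI x) (hβ1 x) (hblk12 x) (hblkY12 x) (hGGco12 x U) (hDco12 x U) (hDsco12 x U)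
  have hGL3 := fun (x : MemberY θ.d₆ θ.ℓ₆ θ.hd' θ.hL' θ.b₀ θ.b₁ Mstar) (U : (bg9YR (Matrix (Fin N) (Fin N) ℂ) (specialUnitaryUnits (Fin N)) R₁ R₂ x).Cfg) => bond_l2ReadsNbr345_of_pins x.toKIdx (trBasis N) (bg9YR (Matrix (Fin N) (Fin N) ℂ) (specialUnitaryUnits (Fin N)) R₁ R₂ x) (fun U => U) (𝔏 x).GG (𝔏 x).parB U (R := (1 : ℝ)) (H := H12 x) (hβI x) (hβ1 x) (hblk12 x) (hGGco12 x U) (hDd x U) (hDds x U)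
  have hsym12 : ∀ x : MemberY θ.d₆ θ.ℓ₆ θ.hd' θ.hL' θ.b₀ θ.b₁ Mstar, M12 ≤ (geo9Y x).M → ∀ α₀ : ℝ, 0 < α₀ → (geo9Y x).M * α₀ ≤ a12 → ∀ U : (bg9YR (Matrix (Fin N) (Fin N) ℂ) (specialUnitaryUnits (Fin N)) R₁ R₂ x).Cfg, (bg9YR (Matrix (Fin N) (Fin N) ℂ) (specialUnitaryUnits (Fin N)) R₁ R₂ x).Reg335 c α₀ U → (bg9YR (Matrix (Fin N) (Fin N) ℂ) (specialUnitaryUnits (Fin N)) R₁ R₂ x).Reg336 c α₀ U → 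
        (IsTransposePair ((𝔬12 x).G U) ((𝔬12 x).G U) ∧ IsTransposePair ((𝔬12 x).G1 U) ((𝔬12 x).G1 U)) ∧
        (IsTransposePair ((𝔬12 x).D U ∘ₗ (𝔬12 x).G U) ((𝔬12 x).G U ∘ₗ (𝔬12 x).Dstar U) ∧ IsTransposePair ((𝔬12 x).D U ∘ₗ (𝔬12 x).G1 U) ((𝔬12 x).G1 U ∘ₗ (𝔬12 x).Dstar U)) :=
    fun x _ α₀ _ _ U hU _ => by
    obtain ⟨hD, h1, -⟩ := hsymD x U (mem_of_reg335R hGR x hU)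
    rw [hGco12 x U, hG1co12 x U, hDco12 x U, hDsco12 x U]
    exact ⟨⟨isTransposePair_GcoK_trBasis x.toKIdx (bg9YR (Matrix (Fin N) (Fin N) ℂ) (specialUnitaryUnits (Fin N)) R₁ R₂ x) (fun U => U) (𝔏 x).GD U hD, isTransposePair_GcoK_trBasis x.toKIdx (bg9YR (Matrix (Fin N) (Fin N) ℂ) (specialUnitaryUnits (Fin N)) R₁ R₂ x) (fun U => U) (𝔏 x).G₁ U h1⟩,
      ⟨isTransposePair_DcoK_GcoK_trBasis x.toKIdx (bg9YR (Matrix (Fin N) (Fin N) ℂ) (specialUnitaryUnits (Fin N)) R₁ R₂ x) (fun U => U) (𝔏 x).GD U hD (fun μ z => specialUnitaryUnits_le_unitaryUnits (mem_of_reg335R hGR x hU μ z)),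
        isTransposePair_DcoK_GcoK_trBasis x.toKIdx (bg9YR (Matrix (Fin N) (Fin N) ℂ) (specialUnitaryUnits (Fin N)) R₁ R₂ x) (fun U => U) (𝔏 x).G₁ U h1 (fun μ z => specialUnitaryUnits_le_unitaryUnits (mem_of_reg335R hGR x hU μ z))⟩⟩
  have hsym13 : ∀ x : MemberY θ.d₆ θ.ℓ₆ θ.hd' θ.hL' θ.b₀ θ.b₁ Mstar, M12 ≤ (geo9Y x).M → ∀ α₀ : ℝ, 0 < α₀ → (geo9Y x).M * α₀ ≤ a12 → ∀ U : (bg9YR (Matrix (Fin N) (Fin N) ℂ) (specialUnitaryUnits (Fin N)) R₁ R₂ x).Cfg, (bg9YR (Matrix (Fin N) (Fin N) ℂ) (specialUnitaryUnits (Fin N)) R₁ R₂ x).Reg335 c α₀ U → (bg9YR (Matrix (Fin N) (Fin N) ℂ) (specialUnitaryUnits (Fin N)) R₁ R₂ x).Reg336 c α₀ U → IsTransposePair ((𝔬12 x).GG U) ((𝔬12 x).GG U) ∧ IsTransposePair ((𝔬12 x).D U ∘ₗ (𝔬12 x).GG U) ((𝔬12 x).GG U ∘ₗ (𝔬12 x).Dstar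 U) :=
    fun x _ α₀ _ _ U hU _ => by
    obtain ⟨-, -, hG⟩ := hsymD x U (mem_of_reg335R hGR x hU)
    rw [hGGco12 x U, hDco12 x U, hDsco12 x U]
    exact ⟨isTransposePair_GcoK_trBasis x.toKIdx (bg9YR (Matrix (Fin N) (Fin N) ℂ) (specialUnitaryUnits (Fin N)) R₁ R₂ x) (fun U => U) (𝔏 x).GG U hG,
      isTransposePair_DcoK_GcoK_trBasis x.toKIdx (bg9YR (Matrix (Fin N) (Fin N) ℂ) (specialUnitaryUnits (Fin N)) R₁ R₂ x) (fun U => U) (𝔏 x).GG U hG (fun μ z => specialUnitaryUnits_le_unitaryUnits (mem_of_reg335R hGR x hU μ z))⟩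
  have hcoR13 := fun (x : MemberY θ.d₆ θ.ℓ₆ θ.hd' θ.hL' θ.b₀ θ.b₁ Mstar) (U : (bg9YR (Matrix (Fin N) (Fin N) ℂ) (specialUnitaryUnits (Fin N)) R₁ R₂ x).Cfg) => And.intro (hGG x U).1 (hGG x U).2.2.1
  have hco1R13 := fun (x : MemberY θ.d₆ θ.ℓ₆ θ.hd' θ.hL' θ.b₀ θ.b₁ Mstar) (U : (bg9YR (Matrix (Fin N) (Fin N) ℂ) (specialUnitaryUnits (Fin N)) R₁ R₂ x).Cfg) => (hGG x U).2.1
  have hcoG13 := fun (x : MemberY θ.d₆ θ.ℓ₆ θ.hd' θ.hL' θ.b₀ θ.b₁ Mstar) (U : (bg9YR (Matrix (Fin N) (Fin N) ℂ) (specialUnitaryUnits (Fin N)) R₁ R₂ x).Cfg) => And.intro (hGG x U).2.2.2.1 (And.intro (hGG x U).2.2.2.2.1 (hGG x U).2.2.2.2.2.1)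
  have hgeoOK : ∀ x : MemberY θ.d₆ θ.ℓ₆ θ.hd' θ.hL' θ.b₀ θ.b₁ Mstar, GeoOK (geo9Y x) := fun x => ⟨geo9Y_dist_triangle x, geo9Y_dist_comm x, geo9K_dist_nonneg x.toKIdx, geo9Y_len_pos x⟩
  -- face v1.5∕v1.6: the DERIVED Z-letters (v1.6: conjunct 5, C₁'s (3.132) class letter, also feeds the block-L² `c1` field of row 21 through `c1L2_of_pinsR`) (q2 q1; gQs2 dgQs; c2 c12 c1_1 from the certificate's own ROW 26) with produced threshold, regime, rate δC, constant
  have hδ30 : 0 < δ12₃ := by linarith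
  -- [CASCADE-K] the kernel slots of `𝔒` read through their `rfl`-pins, in the class-parametric typing (`kernelFamilyR ∘ kernelFamilyB … bg9Y … = kernelFamilyB … bg9YR …` etc., `rfl`)
  have e𝔒GD : ∀ x : MemberY θ.d₆ θ.ℓ₆ θ.hd' θ.hL' θ.b₀ θ.b₁ Mstar, kernelFamilyR R₁ R₂ (𝔒 x).GD = kernelFamilyB x.toKIdx (bg9YR (Matrix (Fin N) (Fin N) ℂ) (specialUnitaryUnits (Fin N)) R₁ R₂ x) (fun U => U) (𝔏 x).GD (𝔏 x).parB := fun x => by rw [h𝔒GD x]; rfl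
  have e𝔒G1 : ∀ x : MemberY θ.d₆ θ.ℓ₆ θ.hd' θ.hL' θ.b₀ θ.b₁ Mstar, kernelFamilyR R₁ R₂ (𝔒 x).G₁ = kernelFamilyB x.toKIdx (bg9YR (Matrix (Fin N) (Fin N) ℂ) (specialUnitaryUnits (Fin N)) R₁ R₂ x) (fun U => U) (𝔏 x).G₁ (𝔏 x).parB := fun x => by rw [h𝔒G₁ x]; rfl
  have e𝔒GG : ∀ x : MemberY θ.d₆ θ.ℓ₆ θ.hd' θ.hL' θ.b₀ θ.b₁ Mstar, kernelFamilyR R₁ R₂ (𝔒 x).GG = kernelFamilyB x.toKIdx (bg9YR (Matrix (Fin N) (Fin N) ℂ) (specialUnitaryUnits (Fin N)) R₁ R₂ x) (fun U => U) (𝔏 x).GG (𝔏 x).parB := fun x => by rw [h𝔒GG x]; rfl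
  have e𝔒H : ∀ x : MemberY θ.d₆ θ.ℓ₆ θ.hd' θ.hL' θ.b₀ θ.b₁ Mstar, hKernelR R₁ R₂ (𝔒 x).H = hKernelOfOp x.toKIdx (bg9YR (Matrix (Fin N) (Fin N) ℂ) (specialUnitaryUnits (Fin N)) R₁ R₂ x) (fun U => U) (𝔏 x).H (𝔏 x).parB := fun x => by rw [h𝔒H x]; rfl
  have e𝔒H1 : ∀ x : MemberY θ.d₆ θ.ℓ₆ θ.hd' θ.hL' θ.b₀ θ.b₁ Mstar, hKernelR R₁ R₂ (𝔒 x).H₁ = hKernelOfOp x.toKIdx (bg9YR (Matrix (Fin N) (Fin N) ℂ) (specialUnitaryUnits (Fin N)) R₁ R₂ x) (fun U => U) (𝔏 x).H₁ (𝔏 x).parB := fun x => by rw [h𝔒H₁ x]; rfl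
  have e𝔒Q : (fun x : MemberY θ.d₆ θ.ℓ₆ θ.hd' θ.hL' θ.b₀ θ.b₁ Mstar => siteKernelR R₁ R₂ (𝔒 x).QGQinv) = fun x => siteKernelOfOpNu x.toKIdx (bg9YR (Matrix (Fin N) (Fin N) ℂ) (specialUnitaryUnits (Fin N)) R₁ R₂ x) (fun U => U) (nuY (θ.d₆ + 1) x.toKIdx) (QGQinvQY x.toKIdx (𝔮 x.toKIdx) (𝔮s x.toKIdx) (parS x.toKIdx) (GpPhysY x.toKIdx (parS x.toKIdx))) := funext fun x => by rw [h𝔒QGQ x]; rfl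
  have e𝔒Q1 : (fun x : MemberY θ.d₆ θ.ℓ₆ θ.hd' θ.hL' θ.b₀ θ.b₁ Mstar => siteKernelR R₁ R₂ (𝔒 x).QG1Qinv) = fun x => siteKernelOfOpNu x.toKIdx (bg9YR (Matrix (Fin N) (Fin N) ℂ) (specialUnitaryUnits (Fin N)) R₁ R₂ x) (fun U => U) (nuY (θ.d₆ + 1) x.toKIdx) (QG1QinvQY x.toKIdx (𝔮 x.toKIdx) (𝔮s x.toKIdx) (parS x.toKIdx) (GpPhysY x.toKIdx (parS x.toKIdx)) (Δ2 x)) := funext fun x => by rw [h𝔒QG1Q x]; rfl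
  rw [e𝔒Q, e𝔒Q1] at h26; simp only [e𝔒GD, e𝔒G1, e𝔒GG, e𝔒H, e𝔒H1] at hH1N hIF hHCN
  obtain ⟨Mz, aC, δC, Bz, hM12z, haC, haC12, hδC, hB3z, hZfam⟩ := zletters_of_laws θ Mstar 𝔮 𝔮s parS Δ2 H12 𝔬12 hblkZ12 hCco12 hC1co12
    ha12 hB12₀ hB12₃ hσ12 hδ30 hδ₃₀ BQp hBQp hqK BQ δQ hBQ hδQ hqsK hG0e he1 h26
  have hBz0 : 0 ≤ Bz := hB12₃.trans hB3z
  -- the master rates of the two leaves, scaled AFTER δC (`…N06ZLettersLegAtPinsPU.scaled_rates`: λ := min 1 (δC ∕ (ρ12 + 2σ12)); the leaf budgets are homogeneous or only easier)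
  obtain ⟨ρs, σs, ρfs, ρ13s, hσs, hρs, hρfs, hρ13s, hρSs, hρδs, hρPs, hρ3s, hρC1, hρf1s, hρf2s, hρ13ρs, hρ13ρ3s, hσρ13s, hρHs⟩ :=
    scaled_rates hσ12 hρ12 hρf12 hρ13 hρS12 hρδ12 hρP12 hδP₃ hρf1 hρf2 hρ13ρ hσρ13 hδC
  obtain ⟨ML12, c12, hrow12⟩ := rowSum261_geo9Y (d := θ.d₆) (ℓ := θ.ℓ₆) (hd := θ.hd') (hL := θ.hL') (b₀ := θ.b₀) (b₁ := θ.b₁) (Mstar := Mstar) σs hσs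
  have hrow : ∀ x : MemberY θ.d₆ θ.ℓ₆ θ.hd' θ.hL' θ.b₀ θ.b₁ Mstar, ML12 ≤ (geo9Y x).M → RowSum (toB6 (geo9Y x) 1 (H12 x)) σs (max c12 0) := fun x hM y => (hrow12 x hM y).trans (le_max_left _ _)
  -- thresholds of the two leaves: the displayed families at M12 ∕ a12 are read above Ms ≥ Mz ≥ M12 and below aC ≤ a12
  set Ms : ℝ := max Mz ML12 with hMsd
  have hMzs : Mz ≤ Ms := le_max_left _ _
  have hM12s : M12 ≤ Ms := hM12z.trans hMzs
  have hMLs : ML12 ≤ Ms := le_max_right _ _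
  have hMs : 0 < Ms := lt_max_of_lt_left (hM12.trans_le hM12z)
  have hE : (fun x K => (𝔒 x).HasRWExp (kernelFamilyRY K)) = fun x => HasRWExpOfOps (𝔬12 x) := by funext x; rw [hpinE x]; rfl
  have hH : (fun x K => (𝔒 x).HasRWExpH (hKernelRY K)) = fun x => HasRWExpHOfOps (𝔬12 x) := by funext x; rw [hpinH x]; rfl
  have hK' : (fun x K => (𝔒 x).PosDefK (kernelFamilyRY K)) = fun x => PosDefKOfOps (𝔬12 x) := by funext x; rw [hpinK x]; rfl
  have hη : ∀ x : MemberY θ.d₆ θ.ℓ₆ θ.hd' θ.hL' θ.b₀ θ.b₁ Mstar, 0 < (geo9Y x).eta := fun x => (distOK_geo9Y x).eta_pos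
  have hL21 := lemma21AboveG_geo9Y (d := θ.d₆) (ℓ := θ.ℓ₆) (hd := θ.hd') (hL := θ.hL') (b₀ := θ.b₀) (b₁ := θ.b₁) (Mstar := Mstar) H12 hα12 (hα12'.trans_lt one_half_lt_one)
  -- the letters of H for ROW 20 at (Bz, min δ12₃ δC), packaged by the leg
  have hHZ := fun x (hM : Ms ≤ (geo9Y x).M) (α₀ : ℝ) (hα : 0 < α₀) (ha : (geo9Y x).M * α₀ ≤ aC) (U : (bg9YR (Matrix (Fin N) (Fin N) ℂ) (specialUnitaryUnits (Fin N)) R₁ R₂ x).Cfg) (hU : (bg9YR (Matrix (Fin N) (Fin N) ℂ) (specialUnitaryUnits (Fin N)) R₁ R₂ x).Reg335 c α₀ U) (hU' : (bg9YR (Matrix (Fin N) (Fin N) ℂ) (specialUnitaryUnits (Fin N)) R₁ R₂ x).Reg336 c α₀ U) =>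
    (hZfam x (hMzs.trans hM) α₀ hα ha U hU hU').2.2.2.2.2.2
  refine ⟨?_, ?_⟩
  · rw [hE, hH, hK']
    simp only [e𝔒GD, e𝔒G1, e𝔒H, e𝔒H1]
    exact thm312Printed_completePairMBZSL_ratesC 𝔬12 (fun _ => 1) H12 𝔭A bHX12 (fun x => (Dd x)) (fun x => (Dds x)) (fun x => kernelFamilyB x.toKIdx (bg9YR (Matrix (Fin N) (Fin N) ℂ) (specialUnitaryUnits (Fin N)) R₁ R₂ x) (fun U => U) (𝔏 x).GD (𝔏 x).parB)
      (fun x => kernelFamilyB x.toKIdx (bg9YR (Matrix (Fin N) (Fin N) ℂ) (specialUnitaryUnits (Fin N)) R₁ R₂ x) (fun U => U) (𝔏 x).G₁ (𝔏 x).parB) (fun x => hKernelOfOp x.toKIdx (bg9YR (Matrix (Fin N) (Fin N) ℂ) (specialUnitaryUnits (Fin N)) R₁ R₂ x) (fun U => U) (𝔏 x).H (𝔏 x).parB)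
      (fun x => hKernelOfOp x.toKIdx (bg9YR (Matrix (Fin N) (Fin N) ℂ) (specialUnitaryUnits (Fin N)) R₁ R₂ x) (fun U => U) (𝔏 x).H₁ (𝔏 x).parB) (fun x => evBK x.toKIdx) (fun x => evBK x.toKIdx) (fun x => RelB x.toKIdx) (2 * (θ.d₆ + 1))
      (nbrCountY θ.d₆ θ.ℓ₆ θ.hd' θ.hL' θ.b₀ θ.b₁ 2) (fun x U => weightNorm (bXH x U) (rwt (geo9Y x) (-1)) (rwt_nonneg (fun y => (geo9Y_len_pos x y).le) (-1))) bXH 2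
      (Real.sqrt ((θ.d₆ + 1) * Fintype.card (TrIdx N))) ((θ.ℓ₆ + 1 : ℕ) : ℝ) θS θD12 θ2₁₂ r12 B12₀ B12₂ δ12₀ δK12 σs (max c12 0) ρs ρfs aC Ms ML12 Bz δ12₃ (min δ12₃ δC) α12 ((θ.ℓ₆ + 1 : ℕ) : ℝ) κS A₀S CR
      δP δP AQ AD CR Bh12 Bi12 Bq12 θH12 AI Bi2₁₂ hθS hθD12 hθH12 hθ2₁₂ hr12 hB12₀ hB12₂ hBz0 hκS hA₀S hCR hAI hδP₀ hδP₃ hρHs hσs.le hρs hρPs hρδs hρPs (le_max_right _ _) haC hMs hα12' hα12.le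
      hρfs hρf1s hρf2s hBh12 hBi12 hBi2₁₂ hBq12 (Real.sqrt_nonneg _) one_le_L_nat hgeoOK (fun x => modelSignsOn_geo9K x.toKIdx) (fun _ => hL1) (fun _ => le_rfl) one_le_L_nat hη hrow hL21
      (hnbr_two_of_le hM₀) (fun x a a' h => len_le_of_dist_le_two_geo9Y x a a' h) hsat hmult hRdist hRlen hcoR12 hco1R12 hcoHR12 hcoG12
      (fun x U => ⟨⟨(hDL x U).1, (hDL x U).2.1, (hDL x U).2.2, (hDL3 x U).1, (hDL3 x U).2.1, (hDL3 x U).2.2⟩, ⟨(h1L x U).1, (h1L x U).2.1, (h1L x U).2.2, (h1L3 x U).1, (h1L3 x U).2.1, (h1L3 x U).2.2⟩⟩)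
      (fun x U => ⟨(hH1N x U).1, (hH1N x U).2.1⟩) (fun x U => ⟨(hIF x U).1, (hIF x U).2.1⟩) hHCN (fun x hM α₀ hα ha => hsym12 x (hM12s.trans hM) α₀ hα (ha.trans haC12)) (fun x hM α₀ hα ha => hmodel12 x (hM12s.trans hM) α₀ hα (ha.trans haC12)) (fun x hM α₀ hα ha => he1 x (hM12s.trans hM) α₀ hα (ha.trans haC12))
      (fun x => weightNorm (BlockNorm.ofBlocks (toB6 (geo9Y x) 1 (H12 x)) (𝔬12 x).blkZ) (fun y => ((((θ.ℓ₆ + 1 : ℕ) : ℝ) ^ (θ.d₆ + 1)) ^ lvl x.hN x.D x.hk y)⁻¹) (fun y => (plateau_pos x.toKIdx y).le)) (fun _ => rfl) hHZ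
      (fun x hM α₀ hα ha U hU hU' => ⟨(hG0C x (hM12s.trans hM) α₀ hα (ha.trans haC12) U hU hU').1, (hG0C x (hM12s.trans hM) α₀ hα (ha.trans haC12) U hU hU').2.2⟩) (fun x hM α₀ hα ha => hStL x (hM12s.trans hM) α₀ hα (ha.trans haC12)) (fun x hM α₀ hα ha => hLHH x (hM12s.trans hM) α₀ hα (ha.trans haC12)) hdomX (fun x hM α₀ hα ha => hst20 x (hM12s.trans hM) α₀ hα (ha.trans haC12)) (fun x hM α₀ hα ha => hst10 x (hM12s.trans hM) α₀ hα (ha.trans haC12))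
  · rw [hE, hK']
    simp only [e𝔒GG]
    exact thm313Printed_completePairMBCZcUSXCEL 𝔬12 (fun _ => 1) H12 (fun x => kernelFamilyB x.toKIdx (bg9YR (Matrix (Fin N) (Fin N) ℂ) (specialUnitaryUnits (Fin N)) R₁ R₂ x) (fun U => U) (𝔏 x).GG (𝔏 x).parB) bH13 𝔭A bHX12 Gp bXH Dd Dds bHW13
      (fun x U => weightNorm (bXH x U) (rwt (geo9Y x) (-1)) (rwt_nonneg (fun y => (geo9Y_len_pos x y).le) (-1))) bXH (fun x => evBK x.toKIdx) (fun x => evBK x.toKIdx) (fun x => RelB x.toKIdx)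
      (2 * (θ.d₆ + 1)) (nbrCountY θ.d₆ θ.ℓ₆ θ.hd' θ.hL' θ.b₀ θ.b₁ 2) 2 (Real.sqrt ((θ.d₆ + 1) * Fintype.card (TrIdx N))) ((θ.ℓ₆ + 1 : ℕ) : ℝ) θS θD12 θ2₁₂ r12 B12₀ B12₂ B13₄ Bz δ12₀ δK12 δP σs
      (max c12 0) ρs aC Ms ML12 Bz δ12₃ δC ρ13s α12 ((θ.ℓ₆ + 1 : ℕ) : ℝ) κ13 κS A₀S AW AQ AD AQ1 CR CR Bh12 Bi12 Bq12 BhD13 Bx13 Bd13 θH12 AI AV Br13 Bi2₁₂ Bd2₁₃ hθS hθD12 hθH12 hθ2₁₂ hκS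
      hA₀S hAW hAQ hAD hAQ1 hCR hCR hAI hAV hr12 hB12₀ hB12₂ hBz0 hB13₄ hBr13 hσs.le hρ13s hρ13ρ3s hρ13ρs hσρ13s hρSs hρ3s hρC1
      hρδs hρPs (le_max_right _ _) haC hMs hα12.le hBi12 hBd13 hBi2₁₂ hBd2₁₃ hBh12 (fun β _ _ => hBq12 β) hBhD13 hBx13 (Real.sqrt_nonneg _) one_le_L_nat hgeoOK
      (fun x => modelSignsOn_geo9K x.toKIdx) (fun _ => hL1) (fun _ => le_rfl) hη hκ13 hκW13 hκX (fun x U => by simp only [weightNorm_κ]; exact (hκX x U).trans hκ13S)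
      (fun x U => (hκX x U).trans hκ13S) (fun _ _ => rfl) (hADB12.trans hB3z) hrow hL21 (hnbr_two_of_le hM₀) (fun x a a' h => len_le_of_dist_le_two_geo9Y x a a' h) hsat hmult hcoR13 hco1R13 hcoG13 (fun x hM α₀ hα ha => hsym13 x (hM12s.trans hM) α₀ hα (ha.trans haC12))
      (fun x U => ⟨(hGL x U).1, (hGL x U).2.1, (hGL x U).2.2, (hGL3 x U).1, (hGL3 x U).2.1, (hGL3 x U).2.2⟩) (fun x U => (hH1N x U).2.2) (fun x U => (hIF x U).2.2) hRdist (fun x hM α₀ hα ha => hmodel12 x (hM12s.trans hM) α₀ hα (ha.trans haC12)) (fun x hM α₀ hα ha => he1 x (hM12s.trans hM) α₀ hα (ha.trans haC12)) (fun (x : MemberY θ.d₆ θ.ℓ₆ θ.hd' θ.hL' θ.b₀ θ.b₁ Mstar) (y : (geo9Y x).Site) => ((((θ.ℓ₆ + 1 : ℕ) : ℝ) ^ (θ.d₆ + 1)) ^ lvl x.hN x.D x.hk y)⁻¹) (fun x y => plateau_pos x.toKIdx y)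
      (fun x hM α₀ hα ha U hU hU' =>
        have ks := fun (a b : (geo9Y x).Site) => kernel_mono (hgeoOK x) hB12₃ hB3z (le_refl δ12₃) a b
        have hz := hZfam x (hMzs.trans hM) α₀ hα ha U hU hU'
        ⟨(hZ2 x (hM12s.trans hM) α₀ hα (ha.trans haC12) U hU hU').1.mono ks, hz.2.1, (hZ2 x (hM12s.trans hM) α₀ hα (ha.trans haC12) U hU hU').2.mono ks, (hrgd2_13 x (hM12s.trans hM) α₀ hα (ha.trans haC12) U hU hU').mono ks,
          hz.2.2.2.2.1, hz.2.2.2.2.2.1, hz.1 2 le_rfl, hz.1 1 (by norm_num)⟩)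
      (fun x hM α₀ hα ha U hU hU' => (hwGp13 x (hM12s.trans hM) α₀ hα (ha.trans haC12) U hU hU').mono fun a b => kernel_mono (hgeoOK x) hB12₃ hB3z (le_refl δ12₃) a b) (fun x hM α₀ hα ha => h152 x (hM12s.trans hM) α₀ hα (ha.trans haC12))
      (fun x hM α₀ hα ha U hU hU' =>
        have ks := fun (a b : (geo9Y x).Site) => kernel_mono (hgeoOK x) hB12₃ hB3z (le_refl δ12₃) a b
        ⟨⟨(hZfam x (hMzs.trans hM) α₀ hα ha U hU hU').2.2.1, (hrgdH13 x (hM12s.trans hM) α₀ hα (ha.trans haC12) U hU hU').mono ks, (hdgDH13 x (hM12s.trans hM) α₀ hα (ha.trans haC12) U hU hU').mono ks⟩,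
        letters313DMZ_mono (hgeoOK x) hB12₃ hB3z (fun β _ _ => hBq12 β) (fun β _ _ => le_refl (Bq12 β)) le_rfl (hlettersDM13 x (hM12s.trans hM) α₀ hα (ha.trans haC12) U hU hU')⟩)
      (fun x hM α₀ hα ha U hU hU' => ⟨(hG0C x (hM12s.trans hM) α₀ hα (ha.trans haC12) U hU hU').1, (hG0C x (hM12s.trans hM) α₀ hα (ha.trans haC12) U hU hU').2.1⟩) (fun x hM α₀ hα ha => hLHH x (hM12s.trans hM) α₀ hα (ha.trans haC12)) (fun x hM α₀ hα ha => hLH3 x (hM12s.trans hM) α₀ hα (ha.trans haC12))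
      (fun x hM α₀ hα ha U hU hU' => (hG0C x (hM12s.trans hM) α₀ hα (ha.trans haC12) U hU hU').2.2) (fun x hM α₀ hα ha => hStL x (hM12s.trans hM) α₀ hα (ha.trans haC12)) (fun (x : MemberY θ.d₆ θ.ℓ₆ θ.hd' θ.hL' θ.b₀ θ.b₁ Mstar) (y : (geo9Y x).Site) => Real.sqrt ((((θ.ℓ₆ + 1 : ℕ) : ℝ) ^ (θ.d₆ + 1)) ^ lvl x.hN x.D x.hk y)⁻¹) (fun x y => Real.sqrt_pos.2 (plateau_pos x.toKIdx y)) (fun x hM α₀ hα ha => hLL2 x (hM12s.trans hM) α₀ hα (ha.trans haC12))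
      (fun x hM α₀ hα ha U hU hU' => c1_l2_of_c1_2 (R₀ := (1 : ℝ)) (H₀ := H12 x) (hgeoOK x) hBz0 (fun y => plateau_pos x.toKIdx y) (hZfam x (hMzs.trans hM) α₀ hα ha U hU hU').2.2.2.2.1 (hC1T x (hM12s.trans hM) α₀ hα (ha.trans haC12) U hU hU')) (fun x hM α₀ hα ha => hrgdd13 x (hM12s.trans hM) α₀ hα (ha.trans haC12)) (fun x hM α₀ hα ha => hdgDvd13 x (hM12s.trans hM) α₀ hα (ha.trans haC12)) (fun x hM α₀ hα ha => hpdgDvd13 x (hM12s.trans hM) α₀ hα (ha.trans haC12)) hdomX hdomW (fun x hM α₀ hα ha => hst21 x (hM12s.trans hM) α₀ hα (ha.trans haC12)) (fun x hM α₀ hα ha => hst11 x (hM12s.trans hM) α₀ hα (ha.trans haC12))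

end Pointed

end Summit.QuantumFields.YangMills.BalabanUVNodes.N06Thm312313AtPinsStateSUCLEPar

end
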